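/-
Copyright (c) 2026. All rights reserved.
Released under Apache 2.0 license as described in the file LICENSE.
-/
import Literature.AlgebraicGeometry.ComplexMultiplication.CyclotomicFermatCMTypesPrimeLevelAsymptotic
import Literature.NumberTheory.GaussSums.GaussJacobiPrime
import Mathlib.NumberTheory.JacobiSum.Basic
import Mathlib.NumberTheory.MulChar.Lemmas
import Mathlib.RingTheory.RootsOfUnity.Complex
import Mathlib.Tactic.NormNum.Prime
import HarnessLib

/-!
# Lenstra's observation made explicit, and Fité–Shparlinski's Corollary 3 corrected: for primes `ℓ ≡ 7 (mod 12)`,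
# `K_ℓ = ∅` iff `ℓ ∈ {7, 19, 31, 43, 79, 103}`

Layer `Literature/AlgebraicGeometry/ComplexMultiplication`; sequel of `CyclotomicFermatCMTypesPrimeLevelAsymptotic`
(lit-deligne-3 gen 16, part 1: FGL Prop. 4.11, FS Thm. 5, and the ERRATUM that «every prime `ℓ ≡ 7 (mod 12)`
distinct from `7` and `19` is degenerate» [FS Cor. 3 = FGL Rem. 3.4] fails at `31, 43, 79, 103`; its docstring
lists «NOT formalised: Lenstra's qualitative observation … (Weil's bound for character sums)»).  This file proves
Lenstra's observation with an explicit threshold and the CORRECT explicit form of Corollary 3.  THEOREMS ONLY (no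
definition, no named fact, no `sorry`).  Here `K_p` («the set of `1 ≤ k ≤ ℓ − 2` for which `D_{k,ℓ}` is singular»,
FS Lemma 6 = [FGL] Thm. 4.10) is rendered, as in the predecessor files, by: `k ≠ 0, −1 (mod p)`, `ord k ≠ 3`, and
`¬ IsNondegenerate (cmTypeOfResidues (fermatCMType p 1 k (−1−k)) _)` — the Fermat CM type `Φ_{S_k}` of the `p`-th
cyclotomic field is degenerate (tree `isNondegenerate_fermat_iff_orderOf`: iff `ord k`, `ord(−k²−k)` odd and
`v₃(ord(−k²−k)) < v₃(ord k)`).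

## The print

F. Fité, I. E. Shparlinski, *On the singularity of the Demjanenko matrix of quotients of Fermat curves*, Proc. AMS
**144** (2016) 55–63 [FiteShparlinski2016] (held `paper:arxiv-1404.5178`, p0001–p0003):

> "Lenstra has shown (see [Gre80]) that `K_ℓ` is non-empty for every sufficiently large `ℓ ≡ 7 (mod 12)`. In this
> note, we give an asymptotic formula for the cardinality of `K_ℓ` …  Theorem 1. Let `ℓ − 1 = 2^α 3^β m` … Then
> `|#K_ℓ − ℓ(1 − 3^{−2β})/2^{2α+2}| ≤ 4β²√ℓ + 33/16`. … Corollary 2. … If `ℓ > 441 · 2^{4α} β⁴` then `#K_ℓ > 0`. …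
> Corollary 3. For every prime `ℓ ≡ 7 (mod 12)` distinct from `7` and `19` we have `#K_ℓ > 0`."
> "Lemma 7. For any polynomial `Q(X) ∈ 𝔽_ℓ[X]` with `N` distinct zeros … and a nonprincipal character `χ` of order
> `s`, `|Σ_{k ∈ 𝔽_ℓ} χ(Q(k))| ≤ (N − 1) ℓ^{1/2}`."  (§3: the sums that occur are `Σ_k χ(k^f (k²+k)^g (−1)^h)`, i.e.
> `N = 2`: Jacobi sums.)

R. Greenberg, *On the Jacobian variety of some algebraic curves*, Compositio Math. **42** (1980/81) 345–359
[Greenberg1980] — the source both [FGL] Remark 3.4 and [FS] cite for the Lenstra–Stark remark.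

## What is proved

For a prime `p ≡ 7 (mod 12)` (`α = 1`, `β ≥ 1`) the following SUFFICIENT condition for `k ∈ K_p` involves only the
quadratic and the cubic character, i.e. ONE character `χ` of order `6`: `χ(k)³ = 1 ≠ χ(k)` (k a square, not a
cube), `χ(k+1)³ = −1` (`k + 1` a non-square, so `−k(k+1)` is a square as `−1` is not), `χ(k(k+1))² = 1`
(`k(k+1)` a cube, so `v₃(ord(−k²−k)) ≤ v₃((p−1)/3) < v₃(p−1) = v₃(ord k)`).  Counting such `k` with Jacobi sums:

* §1 (`‖J(χ, φ)‖ = √p` for `χ, φ, χφ ≠ 1` is the tree's `NumberTheory.GaussSums.norm_jacobiSum`, Ireland–Rosen Ch. 8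
  §3 Cor.), `sum_mul_apply_add_one_eq_jacobiSum` (`Σ_k ψ(k)φ(k+1) = ψ(−1) J(ψ, φ)`), **`norm_sum_mul_apply_add_one_le`**
  = Lemma 7 for `N = 2`: `‖Σ_k ψ(k) φ(k+1)‖ ≤ √p` whenever `(ψ, φ) ≠ (1, 1)`.
* §2 the sextic character through a generator `g` of `(ℤ/p)ˣ` (`χ(g) = ζ`, `ζ` a primitive sixth root of unity —
  instantiated in §6 by Mathlib `MulChar.ofRootOfUnity`): `apply_pow_six`, `pow_ne_one` (order `6`), and the
  dictionary `apply_pow_three_eq_one_iff` (`χ(x)³ = 1 ↔ x^{(p−1)/2} = 1`), `apply_pow_three_eq_neg_one_iff`,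
  `apply_sq_eq_one_iff` (`χ(x)² = 1 ↔ x^{(p−1)/3} = 1`).
* §3 the counts: `U = {k ≠ 0,−1 : χ(k)³ = 1, χ(k+1)³ = −1, (χ(k)χ(k+1))² = 1}`, `U₀ = {χ(k) = 1, χ(k+1) = −1} ⊆ U`,
  `T' = U ∖ U₀`; `twelve_mul_card_U` / `thirtysix_mul_card_U0` (the indicator weights
  `(1+u³)(1−w³)(1+(uw)²+(uw)⁴) = 12·𝟙_U`, `(Σ_{a<6} u^a)(Σ_{b<6} (−w)^b) = 36·𝟙_{U₀}` for sixth roots of unity `u, w`),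
  **`card_U_ge`** (`12·#U ≥ p − 2 − 11√p`: twelve monomials `χ(k)^a χ(k+1)^b`, eleven Weil-bounded),
  **`card_U0_le`** (`36·#U₀ ≤ p − 2 + 35√p`), **`card_T_ge`** (`#T' ≥ (p−2−11√p)/12 − (p−2+35√p)/36`).
* §4 `padicValNat_lt_of_dvd_three_mul` (`d ∣ 3e`, `d ∤ e` ⟹ `v₃(e) < v₃(d)`),
  **`not_isNondegenerate_fermat_of_certificate`** (the CERTIFICATE format: `k^{3e} = 1 ≠ k^e`, `(−k²−k)^e = 1`, `e` odd,
  `k³ ≠ 1` ⟹ `k ∈ K_p`).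
* §5 **`degenerate_of_sextic_conditions`** (Lenstra's mechanism: every `k ∈ T'` satisfies (ii), (iii) of Lemma 6).
* §6 `card_filter_orderOf_eq_three_le_two`, **`exists_not_isNondegenerate_fermat_of_gt`** = LENSTRA'S OBSERVATION,
  EXPLICIT: every prime `p ≡ 7 (mod 12)` with `p > 1296` has `K_p ≠ ∅` (`#T' > 2` once `√p ≥ 36`; at most two
  elements of `T'` are primitive cube roots of unity).
* §7 thirty-three kernel certificates (`cert_439`, …, `cert_1291`: `e = (p−1)/6`, five modular exponentiations each)
  and `exists_not_isNondegenerate_fermat_of_mem_certified` (`K_p ≠ ∅` for the primes `p ≡ 7 (mod 12)` in `[400, 1296]`),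
  `mem_certified_of_le`, `eq_or_le_of_lt_four_hundred` (the prime bookkeeping by `interval_cases` + `norm_num`).
* §8 **`exists_not_isNondegenerate_fermat_iff_not_mem`** = COROLLARY 3 CORRECTED: for a prime `p ≡ 7 (mod 12)`,
  `K_p ≠ ∅ ↔ p ∉ {7, 19, 31, 43, 79, 103}` (below `400`: [FGL] Remark 3.4 as proved in the tree; `[400, 1296]`: §7;
  `> 1296`: §6); `isNondegenerate_fermat_of_mem_exceptions` (the six exceptional primes have `K_p = ∅`);
  **`exists_not_isNondegenerate_fermat_of_gt_103`** = Lenstra's observation with the SHARP threshold `p > 103`.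
* §9 (appended) ON ABELIAN VARIETIES: **`exists_isSimple_exceptional_pow_of_mod_twelve`** (every prime `p ≡ 7 (mod 12)`
  outside the six exceptions has a Fermat type `Φ_{S_k}`, `ord k ≠ 3`, realised by a SIMPLE abelian variety of
  dimension `(p−1)/2` some power of which carries an exceptional Hodge class — realisations by Shimura §6.2 Thm. 3,
  tree `exists_isCMTypeRealisation`; exceptional class by the tree's `isSimple_and_exists_exceptional_pow_of_orderOf`),
  `hodgeConjectureFor_pow_fermat_of_mem_exceptions` (at the six primes every abelian variety of every `Φ_{S_k}`,
  `ord k ≠ 3`, satisfies the Hodge conjecture with all its powers, unconditionally).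

Faithfulness / novelty notes. (i) The printed Corollary 3 is false (part 1 of this seat,
`isNondegenerate_fermat_of_mem_counterexamples`); the statement proved here is its correction and is, as far
as the seat could determine (corpus + galaxy search «Demjanenko matrix|degenerate primes», 2026-08-22), NOT in
print in this form — it is filed as the
proof of the printed qualitative statement (Lenstra, via [Gre80] and [FS] §1) together with the explicit finite
check, the way [FS] intended Cor. 3 to follow from Cor. 2. (ii) [FS] prove Theorem 1 with the full `(α, β)`
bookkeeping and Weil's bound for `Σ χ(Q(k))`; for `ℓ ≡ 7 (mod 12)` the seat's sub-count through ONE sextic character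
suffices and needs only `N = 2` (Jacobi sums, Mathlib), giving the weaker but explicit `#K_p ≥ (p − 2 − 34√p)/18 − 2`.
(iii) A brute-force recount (seat, seconds) confirms `K_p = ∅` exactly for `p ∈ {7,19,31,43,79,103}` among the primes
`p ≡ 7 (mod 12)` below `3000`.  NOT here: [FS] Theorem 1 itself (general `α, β`, two-sided asymptotics), Cor. 2,
Thm. 4; primes `p ≢ 7 (mod 12)`.

## References

* [FiteShparlinski2016] F. Fité, I. E. Shparlinski, Proc. Amer. Math. Soc. 144 (2016) 55–63 (arXiv:1404.5178): §1
  (Lenstra's observation), Thm. 1, Cor. 2, Cor. 3, Lemma 6, Lemma 7, §3.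
* [FiteGonzalezLario2016] F. Fité, J. González, J.-C. Lario, Canad. J. Math. 68 (2016) 361–394: Remark 3.4, Thm. 4.10.
* [Greenberg1980] R. Greenberg, Compositio Math. 42 (1980/81) 345–359 (the Lenstra–Stark remark, as cited by
  [FGL]/[FS]).

## Provenance

Cell `pub-hodgecm2` (COR-CM), literature seat `lit-deligne-3` gen 16 (claim LENSTRA-7MOD12; count-neutral own lane).
-/

noncomputable section

open scoped BigOperators
open Finset ComplexConjugate

namespace Literature.AlgebraicGeometry.ComplexMultiplication

open Literature.NumberTheory.ComplexMultiplication
open Literature.AlgebraicGeometry.Motives (CMType)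
open Literature.AlgebraicGeometry.HodgeTheory (fermatCMType)
open Literature.AlgebraicGeometry.Pohlmann1968 Literature.AlgebraicGeometry.Pohlmann1968.Cyclotomic

namespace CyclotomicFermatCMType

/-! ## §1 Sums of two multiplicative characters at `k` and `k + 1` over `𝔽_p` -/

section PairSums

variable {p : ℕ} [hp : Fact p.Prime]

/-- The pair sum `S(ψ, φ) = Σ_k ψ(k) φ(k + 1)` of two characters is `ψ(−1) J(ψ, φ)`. [folklore] -/
private theorem sum_mul_apply_add_one_eq_jacobiSum (ψ φ : MulChar (ZMod p) ℂ) :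
    ∑ k : ZMod p, ψ k * φ (k + 1) = ψ (-1) * jacobiSum ψ φ := by
  unfold jacobiSum
  rw [Finset.mul_sum]
  refine (Fintype.sum_equiv (Equiv.neg (ZMod p)) _ _ fun x => ?_).symm
  simp only [Equiv.neg_apply]
  rw [← mul_assoc, ← map_mul, sub_eq_add_neg, add_comm]
  ring_nf

/-- `‖ψ(−1)‖ = 1` for a character of a finite field into `ℂ` (a root of unity). [folklore] -/
private theorem norm_apply_neg_one (ψ : MulChar (ZMod p) ℂ) : ‖ψ (-1)‖ = 1 := by
  have h : ψ (-1) ^ 2 = 1 := by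
    rw [← map_pow, neg_one_sq, map_one]
  have := congr_arg norm h
  rw [norm_pow, norm_one] at this
  nlinarith [norm_nonneg (ψ (-1))]

/-- **The Weil bound for the pair sums**: `‖Σ_k ψ(k) φ(k+1)‖ ≤ √p` as soon as `(ψ, φ) ≠ (1, 1)`
(if both are nontrivial with `ψφ ≠ 1` the norm is exactly `√p`; the degenerate cases `ψ = 1`,
`φ = 1`, `φ = ψ⁻¹` have norm `1`; Fité–Shparlinski Lemma 7 with `Q = k^f (k+1)^g`).
[cite: FiteShparlinski2016, Lemma 7] -/
theorem norm_sum_mul_apply_add_one_le {ψ φ : MulChar (ZMod p) ℂ} (h : ψ ≠ 1 ∨ φ ≠ 1) :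
    ‖∑ k : ZMod p, ψ k * φ (k + 1)‖ ≤ Real.sqrt p := by
  have hp1 : (1 : ℝ) ≤ Real.sqrt p := by
    rw [← Real.sqrt_one]
    exact Real.sqrt_le_sqrt (by exact_mod_cast hp.out.one_lt.le)
  rw [sum_mul_apply_add_one_eq_jacobiSum, norm_mul, norm_apply_neg_one, one_mul]
  by_cases hψ : ψ = 1
  · subst hψ
    have hφ : φ ≠ 1 := h.resolve_left (fun h => h rfl)
    rw [jacobiSum_one_nontrivial hφ, norm_neg, norm_one]
    exact hp1
  by_cases hφ : φ = 1
  · subst hφ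
    rw [jacobiSum_comm, jacobiSum_one_nontrivial hψ, norm_neg, norm_one]
    exact hp1
  by_cases hψφ : ψ * φ = 1
  · have : φ = ψ⁻¹ := eq_inv_of_mul_eq_one_right hψφ
    subst this
    rw [jacobiSum_nontrivial_inv hψ, norm_neg, norm_apply_neg_one]
    exact hp1
  · exact (Literature.NumberTheory.GaussSums.norm_jacobiSum hψ hφ hψφ).le

end PairSums


/-! ## §2 A sextic character read through a generator: values vs. power residues -/

section Sextic

variable {p : ℕ} [hp : Fact p.Prime]
variable {g : (ZMod p)ˣ} {ζ : ℂ} {χ : MulChar (ZMod p) ℂ}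

/-- A geometric sum over a root of unity: if `z^n = 1` then `Σ_{i<n} z^i = n` if `z = 1` and `0` otherwise.
[folklore] -/
private theorem geom_sum_eq_ite_of_pow_eq_one {z : ℂ} {n : ℕ} (hz : z ^ n = 1) :
    ∑ i ∈ range n, z ^ i = if z = 1 then (n : ℂ) else 0 := by
  split_ifs with h
  · simp [h]
  · rw [geom_sum_eq h, hz, sub_self, zero_div]

/-- In a domain, `x² = 1` forces `x = ±1`. [folklore] -/
private theorem eq_one_or_eq_neg_one_of_sq_eq_one {R : Type*} [CommRing R] [NoZeroDivisors R] {x : R}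
    (h : x ^ 2 = 1) : x = 1 ∨ x = -1 := by
  have hfac : (x - 1) * (x + 1) = 0 := by linear_combination h
  rcases mul_eq_zero.1 hfac with h1 | h1
  · exact Or.inl (by linear_combination h1)
  · exact Or.inr (by linear_combination h1)

/-- The generator has order `p − 1`. [folklore] -/
private theorem orderOf_generator_eq (hg : ∀ x : (ZMod p)ˣ, x ∈ Subgroup.zpowers g) :
    orderOf (g : ZMod p) = p - 1 := by
  rw [orderOf_units, orderOf_eq_card_of_forall_mem_zpowers hg, Nat.card_eq_fintype_card, ZMod.card_units]

/-- Every non-zero residue is a power of the generator. [folklore] -/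
private theorem exists_pow_generator_eq (hg : ∀ x : (ZMod p)ˣ, x ∈ Subgroup.zpowers g) {x : ZMod p} (hx : x ≠ 0) :
    ∃ a : ℕ, (g : ZMod p) ^ a = x := by
  have hmem : Units.mk0 x hx ∈ Submonoid.powers g := (mem_powers_iff_mem_zpowers).2 (hg _)
  obtain ⟨a, ha⟩ := (Submonoid.mem_powers_iff _ _).1 hmem
  exact ⟨a, by rw [← Units.val_pow_eq_pow_val, ha]; rfl⟩

/-- A power `g^n` of the generator is `1` iff `p − 1 ∣ n`. [folklore] -/
private theorem generator_pow_eq_one_iff (hg : ∀ x : (ZMod p)ˣ, x ∈ Subgroup.zpowers g) (n : ℕ) :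
    (g : ZMod p) ^ n = 1 ↔ p - 1 ∣ n := by
  rw [← orderOf_generator_eq hg, orderOf_dvd_iff_pow_eq_one]

/-- `g^{(p−1)/2} = −1` (the unique element of order `2`). [folklore] -/
private theorem generator_pow_div_two (hg : ∀ x : (ZMod p)ˣ, x ∈ Subgroup.zpowers g) (h2 : 2 ∣ p - 1) :
    (g : ZMod p) ^ ((p - 1) / 2) = -1 := by
  have hp1 : 0 < p - 1 := by have := hp.out.two_le; omega
  have hsq : ((g : ZMod p) ^ ((p - 1) / 2)) ^ 2 = 1 := by
    rw [← pow_mul, Nat.div_mul_cancel h2, generator_pow_eq_one_iff hg]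
  rcases eq_one_or_eq_neg_one_of_sq_eq_one hsq with h | h
  · exfalso
    rw [generator_pow_eq_one_iff hg] at h
    have := Nat.le_of_dvd (Nat.div_pos (Nat.le_of_dvd hp1 h2) two_pos) h
    omega
  · exact h

/-- The power `x^{(p−1)/d}` of `x = g^a` is `1` iff `d ∣ a` (`d ∣ p − 1`). [folklore] -/
private theorem generator_pow_pow_div_eq_one_iff (hg : ∀ x : (ZMod p)ˣ, x ∈ Subgroup.zpowers g) {d : ℕ}
    (hd : d ∣ p - 1) (hd0 : 0 < d) (a : ℕ) :
    ((g : ZMod p) ^ a) ^ ((p - 1) / d) = 1 ↔ d ∣ a := by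
  rw [← pow_mul, generator_pow_eq_one_iff hg]
  obtain ⟨e, he⟩ := hd
  have he0 : 0 < e := by
    rcases Nat.eq_zero_or_pos e with rfl | h
    · have := hp.out.two_le; omega
    · exact h
  rw [he, Nat.mul_div_cancel_left e hd0]
  constructor
  · intro h
    exact Nat.dvd_of_mul_dvd_mul_right he0 h
  · intro h
    exact Nat.mul_dvd_mul_right h e

variable (hg : ∀ x : (ZMod p)ˣ, x ∈ Subgroup.zpowers g) (hζ : IsPrimitiveRoot ζ 6) (hχ : χ g = ζ)
include hg hζ hχ

omit hg hζ in
/-- `χ(g^a) = ζ^a`. [folklore] -/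
private theorem apply_generator_pow (a : ℕ) : χ ((g : ZMod p) ^ a) = ζ ^ a := by
  rw [map_pow, hχ]

omit hg hχ in
/-- `ζ³ = −1` for a primitive sixth root of unity `ζ`. [folklore] -/
private theorem zeta_pow_three : ζ ^ 3 = -1 := by
  have h6 : (ζ ^ 3) ^ 2 = 1 := by rw [← pow_mul]; exact hζ.pow_eq_one
  rcases eq_one_or_eq_neg_one_of_sq_eq_one h6 with h | h
  · exfalso
    have := hζ.dvd_of_pow_eq_one 3 h
    omega
  · exact h

/-- The values of `χ` on units are sixth roots of unity: `χ(x)⁶ = 1`. [folklore] -/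
private theorem apply_pow_six {x : ZMod p} (hx : x ≠ 0) : χ x ^ 6 = 1 := by
  obtain ⟨a, rfl⟩ := exists_pow_generator_eq hg hx
  rw [apply_generator_pow hχ, ← pow_mul, mul_comm, pow_mul, hζ.pow_eq_one, one_pow]

omit hg in
/-- `χ^a ≠ 1` unless `6 ∣ a` (so `χ` has order `6`). [folklore] -/
private theorem pow_ne_one {a : ℕ} (ha : ¬ 6 ∣ a) : χ ^ a ≠ 1 := by
  intro h
  have h1 : (χ ^ a) (g : ZMod p) = 1 := by rw [h, MulChar.one_apply_coe]
  rw [MulChar.pow_apply_coe, hχ] at h1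
  exact ha (hζ.dvd_of_pow_eq_one a h1)

/-- **Dictionary (cubes of values ↔ quadratic residues)**: for `x ≠ 0`, `χ(x)³ = 1 ↔ x^{(p−1)/2} = 1`
(`6 ∣ p − 1`). [folklore] -/
private theorem apply_pow_three_eq_one_iff (h6 : 6 ∣ p - 1) {x : ZMod p} (hx : x ≠ 0) :
    χ x ^ 3 = 1 ↔ x ^ ((p - 1) / 2) = 1 := by
  obtain ⟨a, rfl⟩ := exists_pow_generator_eq hg hx
  rw [apply_generator_pow hχ, generator_pow_pow_div_eq_one_iff hg (dvd_trans (by norm_num) h6) two_pos,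
    ← pow_mul, hζ.pow_eq_one_iff_dvd]
  omega

/-- **Dictionary**: for `x ≠ 0`, `χ(x)³ = −1 ↔ x^{(p−1)/2} = −1`. [folklore] -/
private theorem apply_pow_three_eq_neg_one_iff (h6 : 6 ∣ p - 1) {x : ZMod p} (hx : x ≠ 0) :
    χ x ^ 3 = -1 ↔ x ^ ((p - 1) / 2) = -1 := by
  have hp2 : p ≠ 2 := by
    intro h; rw [h] at h6; norm_num at h6
  have hne : (-1 : ZMod p) ≠ 1 := by
    intro h
    have h2 : (2 : ZMod p) = 0 := by linear_combination -h
    have : ((2 : ℕ) : ZMod p) = 0 := by exact_mod_cast h2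
    rw [ZMod.natCast_eq_zero_iff] at this
    exact hp2 ((Nat.prime_dvd_prime_iff_eq hp.out Nat.prime_two).1 this)
  obtain ⟨a, rfl⟩ := exists_pow_generator_eq hg hx
  rw [apply_generator_pow hχ, ← pow_mul, mul_comm, pow_mul, zeta_pow_three hζ, ← pow_mul,
    mul_comm a, pow_mul, generator_pow_div_two hg (dvd_trans (by norm_num) h6)]
  rcases Nat.even_or_odd a with ha | ha
  · rw [ha.neg_one_pow, ha.neg_one_pow]
    constructor
    · intro h; exact absurd h.symm (by norm_num)
    · intro h; exact absurd h.symm hne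
  · rw [ha.neg_one_pow, ha.neg_one_pow]
    simp

/-- **Dictionary (squares of values ↔ cubic residues)**: for `x ≠ 0`, `χ(x)² = 1 ↔ x^{(p−1)/3} = 1`.
[folklore] -/
private theorem apply_sq_eq_one_iff (h6 : 6 ∣ p - 1) {x : ZMod p} (hx : x ≠ 0) :
    χ x ^ 2 = 1 ↔ x ^ ((p - 1) / 3) = 1 := by
  obtain ⟨a, rfl⟩ := exists_pow_generator_eq hg hx
  rw [apply_generator_pow hχ, generator_pow_pow_div_eq_one_iff hg (dvd_trans (by norm_num) h6)
    (by norm_num), ← pow_mul, hζ.pow_eq_one_iff_dvd]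
  omega

end Sextic


/-! ## §3 Counting `k` with prescribed sextic characters of `k` and `k + 1` -/

section Counting

variable {p : ℕ} [hp : Fact p.Prime]
variable {g : (ZMod p)ˣ} {ζ : ℂ} {χ : MulChar (ZMod p) ℂ}

/-- On units a power of a character is the power of its value. [folklore] -/
private theorem pow_apply_of_ne_zero (χ : MulChar (ZMod p) ℂ) (a : ℕ) {x : ZMod p} (hx : x ≠ 0) :
    (χ ^ a) x = χ x ^ a :=
  MulChar.pow_apply_coe χ a (Units.mk0 x hx)

/-- The pair sums restricted to `k ≠ 0, −1` are the full pair sums of the powers `χ^a`, `χ^b` (a multiplicative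
character kills `0`). [folklore] -/
private theorem sum_filter_pow_mul_pow_eq (χ : MulChar (ZMod p) ℂ) (a b : ℕ) :
    ∑ k ∈ univ.filter (fun k : ZMod p => k ≠ 0 ∧ k + 1 ≠ 0), χ k ^ a * χ (k + 1) ^ b =
      ∑ k : ZMod p, (χ ^ a) k * (χ ^ b) (k + 1) := by
  classical
  rw [← Finset.sum_filter_add_sum_filter_not univ (fun k : ZMod p => k ≠ 0 ∧ k + 1 ≠ 0)
    (fun k => (χ ^ a) k * (χ ^ b) (k + 1))]
  have h2 : ∑ k ∈ univ.filter (fun k : ZMod p => ¬ (k ≠ 0 ∧ k + 1 ≠ 0)),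
      (χ ^ a) k * (χ ^ b) (k + 1) = 0 := by
    refine Finset.sum_eq_zero fun k hk => ?_
    simp only [mem_filter, mem_univ, true_and, not_and_or, not_not] at hk
    rcases hk with hk | hk
    · rw [MulChar.map_nonunit (χ ^ a) (by rw [hk]; exact not_isUnit_zero), zero_mul]
    · rw [MulChar.map_nonunit (χ ^ b) (by rw [hk]; exact not_isUnit_zero), mul_zero]
  rw [h2, add_zero]
  refine Finset.sum_congr rfl fun k hk => ?_
  simp only [mem_filter, mem_univ, true_and] at hk
  rw [pow_apply_of_ne_zero χ a hk.1, pow_apply_of_ne_zero χ b hk.2]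

/-- `#{k : k ≠ 0, −1} = p − 2`. [folklore] -/
private theorem card_filter_ne_zero_ne_neg_one :
    (univ.filter (fun k : ZMod p => k ≠ 0 ∧ k + 1 ≠ 0)).card = p - 2 := by
  classical
  have hne : (0 : ZMod p) ≠ -1 := by
    intro h
    exact one_ne_zero (by linear_combination h : (1 : ZMod p) = 0)
  have hset : univ.filter (fun k : ZMod p => k ≠ 0 ∧ k + 1 ≠ 0) = univ \ {0, -1} := by
    ext k
    simp only [mem_filter, mem_univ, true_and, mem_sdiff, mem_insert, mem_singleton, not_or]
    constructor
    · rintro ⟨h0, h1⟩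
      exact ⟨h0, fun h => h1 (by rw [h, neg_add_cancel])⟩
    · rintro ⟨h0, h1⟩
      exact ⟨h0, fun h => h1 (by linear_combination h)⟩
  rw [hset, Finset.card_sdiff_of_subset (subset_univ _), Finset.card_univ, ZMod.card, Finset.card_pair hne]

variable (hg : ∀ x : (ZMod p)ˣ, x ∈ Subgroup.zpowers g) (hζ : IsPrimitiveRoot ζ 6) (hχ : χ g = ζ)
include hg hζ hχ

omit hg in
/-- **Weil bound for the restricted pair sums `T(a, b) = Σ_{k ≠ 0,−1} χ(k)^a χ(k+1)^b`**, `(a, b) ≢ (0, 0)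
(mod 6)`: `‖T(a, b)‖ ≤ √p`. [cite: FiteShparlinski2016, Lemma 7] -/
theorem norm_sum_filter_pow_mul_pow_le {a b : ℕ} (hab : ¬ 6 ∣ a ∨ ¬ 6 ∣ b) :
    ‖∑ k ∈ univ.filter (fun k : ZMod p => k ≠ 0 ∧ k + 1 ≠ 0), χ k ^ a * χ (k + 1) ^ b‖ ≤ Real.sqrt p := by
  rw [sum_filter_pow_mul_pow_eq]
  refine norm_sum_mul_apply_add_one_le ?_
  rcases hab with h | h
  · exact Or.inl (pow_ne_one hζ hχ h)
  · exact Or.inr (pow_ne_one hζ hχ h)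

omit hg in
/-- Real parts of the restricted pair sums are bounded by `√p` in absolute value. [folklore] -/
private theorem abs_re_sum_filter_pow_mul_pow_le {a b : ℕ} (hab : ¬ 6 ∣ a ∨ ¬ 6 ∣ b) :
    |(∑ k ∈ univ.filter (fun k : ZMod p => k ≠ 0 ∧ k + 1 ≠ 0), χ k ^ a * χ (k + 1) ^ b).re| ≤ Real.sqrt p :=
  (Complex.abs_re_le_norm _).trans (norm_sum_filter_pow_mul_pow_le hζ hχ hab)

omit hg hζ hχ in
/-- The pointwise weight of the set `U`: for sixth roots of unity `u, w`,
`(1 + u³)(1 − w³)(1 + (uw)² + (uw)⁴) = 12·[u³ = 1 ∧ w³ = −1 ∧ (uw)² = 1]`. [folklore] -/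
private theorem weightU_eq_ite {u w : ℂ} (hu : u ^ 6 = 1) (hw : w ^ 6 = 1) :
    (1 + u ^ 3) * (1 - w ^ 3) * (1 + (u * w) ^ 2 + (u * w) ^ 4) =
      if u ^ 3 = 1 ∧ w ^ 3 = -1 ∧ (u * w) ^ 2 = 1 then 12 else 0 := by
  have hu3 : (u ^ 3) ^ 2 = 1 := by rw [← pow_mul]; exact hu
  have hw3 : (w ^ 3) ^ 2 = 1 := by rw [← pow_mul]; exact hw
  have hv3 : ((u * w) ^ 2) ^ 3 = 1 := by
    rw [← pow_mul, mul_pow]; norm_num [hu, hw]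
  rcases eq_one_or_eq_neg_one_of_sq_eq_one hu3 with h1 | h1
  · rcases eq_one_or_eq_neg_one_of_sq_eq_one hw3 with h2 | h2
    · rw [h1, h2, if_neg]
      · ring
      · rintro ⟨-, h, -⟩; norm_num at h
    · by_cases h3 : (u * w) ^ 2 = 1
      · rw [h1, h2, if_pos ⟨rfl, rfl, h3⟩]
        have h4 : (u * w) ^ 4 = 1 := by
          rw [show (u * w) ^ 4 = ((u * w) ^ 2) ^ 2 by ring, h3, one_pow]
        rw [h3, h4]; norm_num
      · rw [if_neg (fun h => h3 h.2.2)]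
        have hq := (sq_add_self_add_one_eq_zero_iff ((u * w) ^ 2)).2 ⟨hv3, h3⟩
        have : 1 + (u * w) ^ 2 + (u * w) ^ 4 = 0 := by linear_combination hq
        rw [this, mul_zero]
  · rw [h1, if_neg]
    · ring
    · rintro ⟨h, -, -⟩; norm_num at h

/-- **`12 · #U` as a character sum**, `U = {k ≠ 0, −1 : χ(k)³ = 1, χ(k+1)³ = −1, (χ(k)χ(k+1))² = 1}`.
[folklore] -/
private theorem twelve_mul_card_U :
    (12 : ℂ) * ((univ.filter (fun k : ZMod p => k ≠ 0 ∧ k + 1 ≠ 0)).filter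
        (fun k => χ k ^ 3 = 1 ∧ χ (k + 1) ^ 3 = -1 ∧ (χ k * χ (k + 1)) ^ 2 = 1)).card =
      ∑ k ∈ univ.filter (fun k : ZMod p => k ≠ 0 ∧ k + 1 ≠ 0),
        (1 + χ k ^ 3) * (1 - χ (k + 1) ^ 3) * (1 + (χ k * χ (k + 1)) ^ 2 + (χ k * χ (k + 1)) ^ 4) := by
  classical
  rw [Finset.sum_congr rfl (fun k hk => by
    simp only [mem_filter, mem_univ, true_and] at hk
    exact weightU_eq_ite (apply_pow_six hg hζ hχ hk.1) (apply_pow_six hg hζ hχ hk.2))]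
  rw [← Finset.sum_filter, Finset.sum_const, nsmul_eq_mul, mul_comm]

/-- **The main term: `12 · #U ≥ p − 2 − 11√p`** (expand the weight into twelve monomials `χ(k)^a χ(k+1)^b`;
the monomial `(0,0)` contributes `p − 2`, the eleven others are Weil-bounded pair sums).
[cite: FiteShparlinski2016, §3 (proof of Thm. 1)] -/
theorem card_U_ge :
    ((p : ℝ) - 2 - 11 * Real.sqrt p) / 12 ≤
      (((univ.filter (fun k : ZMod p => k ≠ 0 ∧ k + 1 ≠ 0)).filter
        (fun k => χ k ^ 3 = 1 ∧ χ (k + 1) ^ 3 = -1 ∧ (χ k * χ (k + 1)) ^ 2 = 1)).card : ℝ) := by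
  classical
  set F' := univ.filter (fun k : ZMod p => k ≠ 0 ∧ k + 1 ≠ 0) with hF'
  set T : ℕ → ℕ → ℂ := fun a b => ∑ k ∈ F', χ k ^ a * χ (k + 1) ^ b with hT
  have hid := twelve_mul_card_U hg hζ hχ
  rw [← hF'] at hid
  have hexp : ∑ k ∈ F', (1 + χ k ^ 3) * (1 - χ (k + 1) ^ 3) *
      (1 + (χ k * χ (k + 1)) ^ 2 + (χ k * χ (k + 1)) ^ 4) =
      T 0 0 + T 2 2 + T 4 4 - T 0 3 - T 2 5 - T 4 7 + T 3 0 + T 5 2 + T 7 4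
        - T 3 3 - T 5 5 - T 7 7 := by
    simp only [hT, ← Finset.sum_add_distrib, ← Finset.sum_sub_distrib]
    refine Finset.sum_congr rfl fun k _ => ?_
    ring
  have h00 : T 0 0 = (p : ℂ) - 2 := by
    simp only [hT, pow_zero, mul_one, Finset.sum_const, nsmul_eq_mul, mul_one]
    rw [hF', card_filter_ne_zero_ne_neg_one, Nat.cast_sub hp.out.two_le]
    norm_num
  set n := ((univ.filter (fun k : ZMod p => k ≠ 0 ∧ k + 1 ≠ 0)).filter
        (fun k => χ k ^ 3 = 1 ∧ χ (k + 1) ^ 3 = -1 ∧ (χ k * χ (k + 1)) ^ 2 = 1)).card with hn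
  have hre := congr_arg Complex.re (hid.trans hexp)
  rw [h00] at hre
  simp only [Complex.mul_re, Complex.add_re, Complex.sub_re, Complex.natCast_re, Complex.natCast_im,
    Complex.re_ofNat, Complex.im_ofNat, mul_zero, sub_zero] at hre
  have b22 := abs_le.1 (abs_re_sum_filter_pow_mul_pow_le hζ hχ (a := 2) (b := 2) (by norm_num))
  have b44 := abs_le.1 (abs_re_sum_filter_pow_mul_pow_le hζ hχ (a := 4) (b := 4) (by norm_num))
  have b03 := abs_le.1 (abs_re_sum_filter_pow_mul_pow_le hζ hχ (a := 0) (b := 3) (by norm_num))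
  have b25 := abs_le.1 (abs_re_sum_filter_pow_mul_pow_le hζ hχ (a := 2) (b := 5) (by norm_num))
  have b47 := abs_le.1 (abs_re_sum_filter_pow_mul_pow_le hζ hχ (a := 4) (b := 7) (by norm_num))
  have b30 := abs_le.1 (abs_re_sum_filter_pow_mul_pow_le hζ hχ (a := 3) (b := 0) (by norm_num))
  have b52 := abs_le.1 (abs_re_sum_filter_pow_mul_pow_le hζ hχ (a := 5) (b := 2) (by norm_num))
  have b74 := abs_le.1 (abs_re_sum_filter_pow_mul_pow_le hζ hχ (a := 7) (b := 4) (by norm_num))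
  have b33 := abs_le.1 (abs_re_sum_filter_pow_mul_pow_le hζ hχ (a := 3) (b := 3) (by norm_num))
  have b55 := abs_le.1 (abs_re_sum_filter_pow_mul_pow_le hζ hχ (a := 5) (b := 5) (by norm_num))
  have b77 := abs_le.1 (abs_re_sum_filter_pow_mul_pow_le hζ hχ (a := 7) (b := 7) (by norm_num))
  simp only [← hF'] at b22 b44 b03 b25 b47 b30 b52 b74 b33 b55 b77
  linarith [b22.1, b44.1, b03.2, b25.2, b47.2, b30.1, b52.1, b74.1, b33.2, b55.2, b77.2]

omit hg hζ hχ in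
/-- The pointwise weight of the set `U₀`: for sixth roots of unity `u, w`,
`(Σ_{a<6} u^a)(Σ_{b<6} (−w)^b) = 36·[u = 1 ∧ w = −1]`. [folklore] -/
private theorem weightU0_eq_ite {u w : ℂ} (hu : u ^ 6 = 1) (hw : w ^ 6 = 1) :
    (∑ a ∈ range 6, u ^ a) * (∑ b ∈ range 6, (-w) ^ b) = if u = 1 ∧ w = -1 then 36 else 0 := by
  have hw' : (-w) ^ 6 = 1 := by rw [neg_pow, hw]; norm_num
  rw [geom_sum_eq_ite_of_pow_eq_one hu, geom_sum_eq_ite_of_pow_eq_one hw']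
  by_cases h1 : u = 1
  · by_cases h2 : w = -1
    · have h2' : -w = 1 := by rw [h2, neg_neg]
      rw [if_pos h1, if_pos h2', if_pos (show u = 1 ∧ w = -1 from ⟨h1, h2⟩)]
      norm_num
    · have h2' : ¬ (-w = 1) := fun h => h2 (by linear_combination -h)
      rw [if_pos h1, if_neg h2', if_neg (show ¬ (u = 1 ∧ w = -1) from fun h => h2 h.2), mul_zero]
  · rw [if_neg h1, if_neg (show ¬ (u = 1 ∧ w = -1) from fun h => h1 h.1), zero_mul]

/-- **`36 · #U₀` as a character sum**, `U₀ = {k ≠ 0, −1 : χ(k) = 1, χ(k+1) = −1}`. [folklore] -/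
private theorem thirtysix_mul_card_U0 :
    (36 : ℂ) * ((univ.filter (fun k : ZMod p => k ≠ 0 ∧ k + 1 ≠ 0)).filter
        (fun k => χ k = 1 ∧ χ (k + 1) = -1)).card =
      ∑ k ∈ univ.filter (fun k : ZMod p => k ≠ 0 ∧ k + 1 ≠ 0),
        (∑ a ∈ range 6, χ k ^ a) * (∑ b ∈ range 6, (-χ (k + 1)) ^ b) := by
  classical
  rw [Finset.sum_congr rfl (fun k hk => by
    simp only [mem_filter, mem_univ, true_and] at hk
    exact weightU0_eq_ite (apply_pow_six hg hζ hχ hk.1) (apply_pow_six hg hζ hχ hk.2))]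
  rw [← Finset.sum_filter, Finset.sum_const, nsmul_eq_mul, mul_comm]

/-- **The subtracted term: `36 · #U₀ ≤ p − 2 + 35√p`** (thirty-six monomials, one main term).
[cite: FiteShparlinski2016, §3 (proof of Thm. 1)] -/
theorem card_U0_le :
    (((univ.filter (fun k : ZMod p => k ≠ 0 ∧ k + 1 ≠ 0)).filter
        (fun k => χ k = 1 ∧ χ (k + 1) = -1)).card : ℝ) ≤ ((p : ℝ) - 2 + 35 * Real.sqrt p) / 36 := by
  classical
  set F' := univ.filter (fun k : ZMod p => k ≠ 0 ∧ k + 1 ≠ 0) with hF'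
  set T : ℕ × ℕ → ℂ := fun ab => ∑ k ∈ F', χ k ^ ab.1 * χ (k + 1) ^ ab.2 with hT
  set n := (F'.filter (fun k => χ k = 1 ∧ χ (k + 1) = -1)).card with hn
  have hid := thirtysix_mul_card_U0 hg hζ hχ
  rw [← hF', ← hn] at hid
  -- expand the product of the two geometric sums
  have hexp : ∑ k ∈ F', (∑ a ∈ range 6, χ k ^ a) * (∑ b ∈ range 6, (-χ (k + 1)) ^ b) =
      ∑ a ∈ range 6, ∑ b ∈ range 6, (-1 : ℂ) ^ b * T (a, b) := by
    calc ∑ k ∈ F', (∑ a ∈ range 6, χ k ^ a) * (∑ b ∈ range 6, (-χ (k + 1)) ^ b)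
        = ∑ k ∈ F', ∑ a ∈ range 6, ∑ b ∈ range 6, χ k ^ a * (-χ (k + 1)) ^ b := by
          refine Finset.sum_congr rfl fun k _ => ?_
          rw [Finset.sum_mul_sum]
      _ = ∑ a ∈ range 6, ∑ k ∈ F', ∑ b ∈ range 6, χ k ^ a * (-χ (k + 1)) ^ b := Finset.sum_comm
      _ = ∑ a ∈ range 6, ∑ b ∈ range 6, ∑ k ∈ F', χ k ^ a * (-χ (k + 1)) ^ b := by
          refine Finset.sum_congr rfl fun a _ => ?_
          exact Finset.sum_comm
      _ = ∑ a ∈ range 6, ∑ b ∈ range 6, (-1 : ℂ) ^ b * T (a, b) := by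
          refine Finset.sum_congr rfl fun a _ => Finset.sum_congr rfl fun b _ => ?_
          simp only [hT, Finset.mul_sum]
          refine Finset.sum_congr rfl fun k _ => ?_
          rw [neg_pow]
          ring
  have hprod : ∑ ab ∈ range 6 ×ˢ range 6, (-1 : ℂ) ^ ab.2 * T ab =
      ∑ a ∈ range 6, ∑ b ∈ range 6, (-1 : ℂ) ^ b * T (a, b) := by
    rw [Finset.sum_product]
  have h00mem : ((0, 0) : ℕ × ℕ) ∈ range 6 ×ˢ range 6 := by simp
  rw [hexp, ← hprod, ← Finset.add_sum_erase _ _ h00mem] at hid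
  have h00 : (-1 : ℂ) ^ ((0, 0) : ℕ × ℕ).2 * T (0, 0) = (p : ℂ) - 2 := by
    simp only [hT, pow_zero, mul_one, one_mul, Finset.sum_const, nsmul_eq_mul]
    rw [hF', card_filter_ne_zero_ne_neg_one, Nat.cast_sub hp.out.two_le]
    norm_num
  rw [h00] at hid
  set S := ∑ ab ∈ (range 6 ×ˢ range 6).erase ((0, 0) : ℕ × ℕ), (-1 : ℂ) ^ ab.2 * T ab with hS
  -- bound the 35 remaining terms
  have hcard : ((range 6 ×ˢ range 6).erase ((0, 0) : ℕ × ℕ)).card = 35 := by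
    rw [Finset.card_erase_of_mem h00mem, Finset.card_product, Finset.card_range]
  have hbound : ∀ ab ∈ (range 6 ×ˢ range 6).erase ((0, 0) : ℕ × ℕ),
      ((-1 : ℂ) ^ ab.2 * T ab).re ≤ Real.sqrt p := by
    intro ab hab
    simp only [mem_erase, mem_product, mem_range, ne_eq, Prod.ext_iff] at hab
    refine (Complex.re_le_norm _).trans ?_
    rw [norm_mul, norm_pow, norm_neg, norm_one, one_pow, one_mul]
    refine norm_sum_filter_pow_mul_pow_le hζ hχ ?_
    omega
  have hsum := Finset.sum_le_sum hbound
  rw [Finset.sum_const, hcard, nsmul_eq_mul, ← Complex.re_sum, ← hS] at hsum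
  push_cast at hsum
  have hre := congr_arg Complex.re hid
  simp only [Complex.mul_re, Complex.add_re, Complex.sub_re, Complex.natCast_re, Complex.natCast_im,
    Complex.re_ofNat, Complex.im_ofNat, mul_zero, sub_zero] at hre
  have h36 : (36 : ℝ) * n ≤ (p : ℝ) - 2 + 35 * Real.sqrt p := by
    rw [hre]
    linarith
  linarith

omit hg hζ hχ in
/-- `U₀` is the part of `U` where `χ(k) = 1` (there `χ(k+1) = −1` is forced). [folklore] -/
private theorem filter_U_apply_eq_one :
    ((univ.filter (fun k : ZMod p => k ≠ 0 ∧ k + 1 ≠ 0)).filter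
        (fun k => χ k ^ 3 = 1 ∧ χ (k + 1) ^ 3 = -1 ∧ (χ k * χ (k + 1)) ^ 2 = 1)).filter
        (fun k => χ k = 1) =
      (univ.filter (fun k : ZMod p => k ≠ 0 ∧ k + 1 ≠ 0)).filter
        (fun k => χ k = 1 ∧ χ (k + 1) = -1) := by
  classical
  ext k
  simp only [mem_filter, mem_univ, true_and]
  constructor
  · rintro ⟨⟨hk, h3, hw3, huw⟩, h1⟩
    refine ⟨hk, h1, ?_⟩
    rw [h1, one_mul] at huw
    linear_combination hw3 - (χ (k + 1)) * huw
  · rintro ⟨hk, h1, h2⟩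
    refine ⟨⟨hk, by rw [h1, one_pow], by rw [h2]; norm_num, by rw [h1, h2]; norm_num⟩, h1⟩

/-- **The count: `#T' ≥ (p − 2 − 11√p)/12 − (p − 2 + 35√p)/36`**, where
`T' = {k ≠ 0, −1 : χ(k)³ = 1, χ(k) ≠ 1, χ(k+1)³ = −1, (χ(k)χ(k+1))² = 1} = U ∖ U₀`.
[cite: FiteShparlinski2016, Thm. 1 (the main term `ℓ(1 − 3^{−2β})/2^{2α+2}` for `α = 1`)] -/
theorem card_T_ge :
    ((p : ℝ) - 2 - 11 * Real.sqrt p) / 12 - ((p : ℝ) - 2 + 35 * Real.sqrt p) / 36 ≤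
      ((((univ.filter (fun k : ZMod p => k ≠ 0 ∧ k + 1 ≠ 0)).filter
        (fun k => χ k ^ 3 = 1 ∧ χ (k + 1) ^ 3 = -1 ∧ (χ k * χ (k + 1)) ^ 2 = 1)).filter
        (fun k => χ k ≠ 1)).card : ℝ) := by
  classical
  have hsplit := Finset.card_filter_add_card_filter_not
    (s := (univ.filter (fun k : ZMod p => k ≠ 0 ∧ k + 1 ≠ 0)).filter
        (fun k => χ k ^ 3 = 1 ∧ χ (k + 1) ^ 3 = -1 ∧ (χ k * χ (k + 1)) ^ 2 = 1))
    (fun k => χ k = 1)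
  rw [filter_U_apply_eq_one] at hsplit
  have hU := card_U_ge hg hζ hχ
  have hU0 := card_U0_le hg hζ hχ
  have hcast := congr_arg (fun n : ℕ => (n : ℝ)) hsplit
  push_cast at hcast
  linarith

end Counting


/-! ## §4 `3`-adic bookkeeping and the certificate format -/

section Valuation

/-- If `d ∣ e ≠ 0` then `v₃(d) ≤ v₃(e)`. [folklore] -/
private theorem padicValNat_le_of_dvd {d e : ℕ} (he : e ≠ 0) (h : d ∣ e) :
    padicValNat 3 d ≤ padicValNat 3 e :=
  (padicValNat_dvd_iff_le he).1 (dvd_trans pow_padicValNat_dvd h)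

/-- **If `d ∣ 3e` but `d ∤ e` then `v₃(d) > v₃(e)`** (indeed `v₃(d) = v₃(e) + 1`): the `3`-free part of `d`
divides `e`, so the `3`-part of `d` cannot. [folklore] -/
private theorem padicValNat_lt_of_dvd_three_mul {d e : ℕ} (h1 : d ∣ 3 * e) (h2 : ¬ d ∣ e) :
    padicValNat 3 e < padicValNat 3 d := by
  have hd : d ≠ 0 := by
    rintro rfl
    rw [zero_dvd_iff] at h1
    omega
  obtain ⟨s, c, hc, hdc⟩ := Nat.exists_eq_pow_mul_and_not_dvd hd 3 (by norm_num)
  have hcop : Nat.Coprime 3 c := (Nat.Prime.coprime_iff_not_dvd Nat.prime_three).2 hc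
  have hcd : c ∣ 3 * e := dvd_trans (Dvd.intro_left _ hdc.symm) h1
  have hce : c ∣ e := (hcop.symm).dvd_of_dvd_mul_left hcd
  by_contra hlt
  rw [not_lt] at hlt
  have hs : s ≤ padicValNat 3 e := by
    have : 3 ^ s ∣ d := Dvd.intro _ hdc.symm
    exact le_trans ((padicValNat_dvd_iff_le hd).1 this) hlt
  have h3e : 3 ^ s ∣ e := dvd_trans (pow_dvd_pow 3 hs) pow_padicValNat_dvd
  have : d ∣ e := by
    rw [hdc]
    exact Nat.Coprime.mul_dvd_of_dvd_of_dvd (hcop.pow_left s) h3e hce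
  exact h2 this

variable {p : ℕ} [hp : Fact p.Prime] (L : Type) [Field L] [NumberField L] [IsCyclotomicExtension {p} ℚ L]

/-- **The CERTIFICATE for `K_p ≠ ∅`**: if `k ≠ 0, −1` satisfies `k^{3e} = 1`, `k^e ≠ 1`, `(−k²−k)^e = 1` for an
ODD `e`, and `k³ ≠ 1`, then `ord k ∣ 3e` is odd, `ord(−k²−k) ∣ e` is odd with `v₃ ≤ v₃(e) < v₃(ord k)` — so
`k ∈ K_p`: `ord k ≠ 3` and `Φ_{S_k}` is degenerate (Lemma 6 / [FGL] Thm. 4.10).  Used below with `e = (p−1)/6`.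
[cite: FiteShparlinski2016, Lemma 6] [cite: FiteGonzalezLario2016, Thm. 4.10] -/
theorem not_isNondegenerate_fermat_of_certificate {a : ZMod p} (ha : a ≠ 0) (ha1 : 1 + a ≠ 0) {e : ℕ}
    (he : Odd e) (h3 : a ^ 3 ≠ 1) (hM : a ^ (3 * e) = 1) (hne : a ^ e ≠ 1) (hh : (-a ^ 2 - a) ^ e = 1)
    {hS : ∀ c : ZMod p, c.val.Coprime p → (c ∈ fermatCMType p 1 a (-1 - a) ↔ -c ∉ fermatCMType p 1 a (-1 - a))} :
    orderOf a ≠ 3 ∧ ¬ IsNondegenerate (cmTypeOfResidues (L := L) (fermatCMType p 1 a (-1 - a)) hS) := by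
  have he0 : e ≠ 0 := by rintro rfl; exact hne (pow_zero a)
  have hda : orderOf a ∣ 3 * e := orderOf_dvd_of_pow_eq_one hM
  have hdh : orderOf (-a ^ 2 - a) ∣ e := orderOf_dvd_of_pow_eq_one hh
  have hnd : ¬ orderOf a ∣ e := fun h => hne (orderOf_dvd_iff_pow_eq_one.1 h)
  refine ⟨fun h => h3 (by rw [← h]; exact pow_orderOf_eq_one a), ?_⟩
  rw [isNondegenerate_fermat_iff_orderOf L ha ha1, not_not]
  refine ⟨he.of_dvd_nat hdh, (Odd.mul (by decide : Odd 3) he).of_dvd_nat hda, ?_⟩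
  exact lt_of_le_of_lt (padicValNat_le_of_dvd he0 hdh) (padicValNat_lt_of_dvd_three_mul hda hnd)

end Valuation

/-! ## §5 Lenstra's mechanism: the elements of `T'` are degenerate -/

section Mechanism

variable {p : ℕ} [hp : Fact p.Prime]
variable {g : (ZMod p)ˣ} {ζ : ℂ} {χ : MulChar (ZMod p) ℂ}
variable (hg : ∀ x : (ZMod p)ˣ, x ∈ Subgroup.zpowers g) (hζ : IsPrimitiveRoot ζ 6) (hχ : χ g = ζ)
include hg hζ hχ

/-- **Lenstra's mechanism** («Lenstra has shown (see [Gre80]) that `K_ℓ` is non-empty for every sufficiently large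
`ℓ ≡ 7 (mod 12)`»): for `p ≡ 7 (mod 12)` and a sextic character `χ`, every `k ≠ 0, −1` with `χ(k)³ = 1 ≠ χ(k)`,
`χ(k+1)³ = −1`, `(χ(k)χ(k+1))² = 1` — i.e. `k` a square but not a cube, `k + 1` a non-square, `k(k+1)` a cube —
satisfies (ii) and (iii) of Lemma 6: `ord k`, `ord(−k²−k)` odd and `v₃(ord(−k²−k)) ≤ v₃((p−1)/3) < v₃(ord k)`.
[cite: FiteShparlinski2016, §1 (Lenstra's observation) and Lemma 6] [cite: Greenberg1980, (Lenstra–Stark remark)] -/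
theorem degenerate_of_sextic_conditions (h12 : p % 12 = 7) {k : ZMod p} (hk : k ≠ 0) (hk1 : k + 1 ≠ 0)
    (hu3 : χ k ^ 3 = 1) (hu1 : χ k ≠ 1) (hw3 : χ (k + 1) ^ 3 = -1) (huw : (χ k * χ (k + 1)) ^ 2 = 1) :
    Odd (orderOf (-k ^ 2 - k)) ∧ Odd (orderOf k) ∧
      padicValNat 3 (orderOf (-k ^ 2 - k)) < padicValNat 3 (orderOf k) := by
  have hp7 : 7 ≤ p := by
    have := hp.out.two_le
    omega
  have h6 : 6 ∣ p - 1 := by omega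
  have hodd2 : Odd ((p - 1) / 2) := by
    rw [Nat.odd_iff]; omega
  have heven3 : Even ((p - 1) / 3) := by
    rw [Nat.even_iff]; omega
  have h30 : (p - 1) / 3 ≠ 0 := by omega
  -- power conditions
  have hk2 : k ^ ((p - 1) / 2) = 1 := (apply_pow_three_eq_one_iff hg hζ hχ h6 hk).1 hu3
  have hk12 : (k + 1) ^ ((p - 1) / 2) = -1 := (apply_pow_three_eq_neg_one_iff hg hζ hχ h6 hk1).1 hw3
  have hkk : (k * (k + 1)) ^ ((p - 1) / 3) = 1 :=
    (apply_sq_eq_one_iff hg hζ hχ h6 (mul_ne_zero hk hk1)).1 (by rw [map_mul]; exact huw)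
  have hk3 : k ^ ((p - 1) / 3) ≠ 1 := by
    intro h
    have hu2 : χ k ^ 2 = 1 := (apply_sq_eq_one_iff hg hζ hχ h6 hk).2 h
    exact hu1 (by linear_combination hu3 - χ k * hu2)
  -- the element `h = −k² − k = −k(k+1)`
  have hh : -k ^ 2 - k = -(k * (k + 1)) := by ring
  have hh2 : (-k ^ 2 - k) ^ ((p - 1) / 2) = 1 := by
    rw [hh, neg_pow, mul_pow, hk2, hk12, hodd2.neg_one_pow]; ring
  have hh3 : (-k ^ 2 - k) ^ ((p - 1) / 3) = 1 := by
    rw [hh, neg_pow, hkk, heven3.neg_one_pow, one_mul]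
  -- orders
  have hdk : orderOf k ∣ 3 * ((p - 1) / 3) := by
    rw [Nat.mul_div_cancel' (dvd_trans (by norm_num) h6)]
    exact ZMod.orderOf_dvd_card_sub_one hk
  have hndk : ¬ orderOf k ∣ (p - 1) / 3 := fun h => hk3 (orderOf_dvd_iff_pow_eq_one.1 h)
  have hdh3 : orderOf (-k ^ 2 - k) ∣ (p - 1) / 3 := orderOf_dvd_of_pow_eq_one hh3
  refine ⟨hodd2.of_dvd_nat (orderOf_dvd_of_pow_eq_one hh2), hodd2.of_dvd_nat (orderOf_dvd_of_pow_eq_one hk2), ?_⟩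
  exact lt_of_le_of_lt (padicValNat_le_of_dvd h30 hdh3) (padicValNat_lt_of_dvd_three_mul hdk hndk)

end Mechanism


/-! ## §6 Lenstra's observation, explicit: every prime `p ≡ 7 (mod 12)`, `p > 1296`, has `K_p ≠ ∅` -/

section Lenstra

variable {p : ℕ} [hp : Fact p.Prime] (L : Type) [Field L] [NumberField L] [IsCyclotomicExtension {p} ℚ L]

omit hp in
/-- At most two residues have order `3` (they are roots of `X² + X + 1`). [folklore] -/
private theorem card_filter_orderOf_eq_three_le_two [Fact p.Prime] :
    (univ.filter (fun k : ZMod p => orderOf k = 3)).card ≤ 2 := by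
  classical
  set E := univ.filter (fun k : ZMod p => orderOf k = 3) with hE
  have hroot : ∀ k ∈ E, k ^ 2 + k + 1 = 0 := by
    intro k hk
    simp only [hE, mem_filter, mem_univ, true_and] at hk
    have h3 : k ^ 3 = 1 := by rw [← hk]; exact pow_orderOf_eq_one k
    have h1 : k ≠ 1 := by rintro rfl; rw [orderOf_one] at hk; norm_num at hk
    have hfac : (k - 1) * (k ^ 2 + k + 1) = 0 := by linear_combination h3
    exact (mul_eq_zero.1 hfac).resolve_left (sub_ne_zero.2 h1)
  rcases E.eq_empty_or_nonempty with h | ⟨x₀, hx₀⟩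
  · rw [h]; simp
  · have hsub : E ⊆ {x₀, -1 - x₀} := by
      intro y hy
      have hx := hroot x₀ hx₀
      have hyr := hroot y hy
      have hfac : (y - x₀) * (y + x₀ + 1) = 0 := by linear_combination hyr - hx
      simp only [mem_insert, mem_singleton]
      rcases mul_eq_zero.1 hfac with h | h
      · exact Or.inl (by linear_combination h)
      · exact Or.inr (by linear_combination h)
    exact (Finset.card_le_card hsub).trans Finset.card_le_two

/-- **Lenstra's observation («every sufficiently large prime `ℓ ≡ 7 (mod 12)` is degenerate», [Gre80];
Fité–Shparlinski §1), EXPLICIT: every prime `p ≡ 7 (mod 12)` with `p > 1296` has `K_p ≠ ∅`** — some Fermat CM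
type `Φ_{S_k}` of the `p`-th cyclotomic field (`k ≠ 0, −1`, `ord k ≠ 3`) is degenerate.  Proof: with a sextic
character `χ` (a generator `g ↦ e^{2πi/6}`), the set `T'` of §3 has `#T' ≥ (p−2−11√p)/12 − (p−2+35√p)/36 > 2`
for `√p ≥ 36`, at most two of its elements are cube roots of unity, and the others are degenerate by §5.
[cite: FiteShparlinski2016, §1 (Lenstra's observation) and Cor. 2] [cite: Greenberg1980, (Lenstra–Stark remark)] -/
theorem exists_not_isNondegenerate_fermat_of_gt (h12 : p % 12 = 7) (hbig : 1296 < p) :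
    ∃ a : ZMod p, ∃ (ha : a ≠ 0) (ha1 : 1 + a ≠ 0), orderOf a ≠ 3 ∧
      ¬ IsNondegenerate (cmTypeOfResidues (L := L) (fermatCMType p 1 a (-1 - a)) (fermatCMType_one_cm ha ha1)) := by
  classical
  have h6 : 6 ∣ p - 1 := by omega
  -- a generator and the sextic character `g ↦ ζ₆`
  obtain ⟨g, hg⟩ := IsCyclic.exists_generator (α := (ZMod p)ˣ)
  have hζ : IsPrimitiveRoot (Complex.exp (2 * Real.pi * Complex.I / (6 : ℕ))) 6 :=
    Complex.isPrimitiveRoot_exp 6 (by norm_num)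
  set ζ : ℂ := Complex.exp (2 * Real.pi * Complex.I / (6 : ℕ)) with hζdef
  have hζunit : IsUnit ζ := hζ.isUnit (by norm_num)
  have hζmem : hζunit.unit ∈ rootsOfUnity (Fintype.card (ZMod p)ˣ) ℂ := by
    rw [mem_rootsOfUnity, ZMod.card_units, Units.ext_iff, Units.val_pow_eq_pow_val, IsUnit.unit_spec,
      Units.val_one]
    exact (hζ.pow_eq_one_iff_dvd _).2 h6
  set χ : MulChar (ZMod p) ℂ := MulChar.ofRootOfUnity hζmem hg with hχdef
  have hχ : χ g = ζ := by
    have h := MulChar.ofRootOfUnity_spec hζmem hg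
    rw [← hχdef] at h
    rw [h, IsUnit.unit_spec]
  -- the set `T'`
  set T' := ((univ.filter (fun k : ZMod p => k ≠ 0 ∧ k + 1 ≠ 0)).filter
        (fun k => χ k ^ 3 = 1 ∧ χ (k + 1) ^ 3 = -1 ∧ (χ k * χ (k + 1)) ^ 2 = 1)).filter
        (fun k => χ k ≠ 1) with hT'
  have hcount := card_T_ge hg hζ hχ
  rw [← hT'] at hcount
  have hsqrt : (36 : ℝ) ≤ Real.sqrt p := by
    have h36 : (36 : ℝ) = Real.sqrt ((36 : ℝ) ^ 2) := by rw [Real.sqrt_sq (by norm_num)]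
    rw [h36]
    exact Real.sqrt_le_sqrt (by norm_num; exact_mod_cast hbig.le)
  have hsq : Real.sqrt (p : ℝ) ^ 2 = p := Real.sq_sqrt (Nat.cast_nonneg p)
  have h3 : (2 : ℝ) < (T'.card : ℝ) := by nlinarith
  have h3' : 3 ≤ T'.card := by exact_mod_cast h3
  -- remove the (at most two) primitive cube roots of unity
  have hE := card_filter_orderOf_eq_three_le_two (p := p)
  obtain ⟨k, hkT, hk3⟩ : ∃ k ∈ T', orderOf k ≠ 3 := by
    by_contra hno
    have hsub : T' ⊆ univ.filter (fun k : ZMod p => orderOf k = 3) := by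
      intro k hk
      simp only [mem_filter, mem_univ, true_and]
      by_contra h
      exact hno ⟨k, hk, h⟩
    have := (Finset.card_le_card hsub).trans hE
    omega
  simp only [hT', mem_filter, mem_univ, true_and] at hkT
  obtain ⟨⟨⟨hk0, hk1⟩, hu3, hw3, huw⟩, hu1⟩ := hkT
  have hk1' : 1 + k ≠ 0 := by rwa [add_comm]
  refine ⟨k, hk0, hk1', hk3, ?_⟩
  rw [isNondegenerate_fermat_iff_orderOf L hk0 hk1', not_not]
  exact degenerate_of_sextic_conditions hg hζ hχ h12 hk0 hk1 hu3 hu1 hw3 huw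

end Lenstra

/-! ## §7 The primes `400 ≤ p ≤ 1296`, `p ≡ 7 (mod 12)`: thirty-three certificates -/

section Certificates

variable {p : ℕ} [hp : Fact p.Prime] (L : Type) [Field L] [NumberField L] [IsCyclotomicExtension {p} ℚ L]

/-- Certificate at `p = 439`: `k = 29`, `e = (p−1)/6 = 73`. [cite: FiteShparlinski2016, Lemma 6] -/
private theorem cert_439 : (29 : ZMod 439) ≠ 0 ∧ (1 : ZMod 439) + 29 ≠ 0 ∧ (29 : ZMod 439) ^ 3 ≠ 1 ∧
    (29 : ZMod 439) ^ (3 * 73) = 1 ∧ (29 : ZMod 439) ^ 73 ≠ 1 ∧ (-(29 : ZMod 439) ^ 2 - 29) ^ 73 = 1 := by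
  refine ⟨?_, ?_, ?_, ?_, ?_, ?_⟩ <;> decide +kernel

/-- Certificate at `p = 463`: `k = 25`, `e = (p−1)/6 = 77`. [cite: FiteShparlinski2016, Lemma 6] -/
private theorem cert_463 : (25 : ZMod 463) ≠ 0 ∧ (1 : ZMod 463) + 25 ≠ 0 ∧ (25 : ZMod 463) ^ 3 ≠ 1 ∧
    (25 : ZMod 463) ^ (3 * 77) = 1 ∧ (25 : ZMod 463) ^ 77 ≠ 1 ∧ (-(25 : ZMod 463) ^ 2 - 25) ^ 77 = 1 := by
  refine ⟨?_, ?_, ?_, ?_, ?_, ?_⟩ <;> decide +kernel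

/-- Certificate at `p = 487`: `k = 9`, `e = (p−1)/6 = 81`. [cite: FiteShparlinski2016, Lemma 6] -/
private theorem cert_487 : (9 : ZMod 487) ≠ 0 ∧ (1 : ZMod 487) + 9 ≠ 0 ∧ (9 : ZMod 487) ^ 3 ≠ 1 ∧
    (9 : ZMod 487) ^ (3 * 81) = 1 ∧ (9 : ZMod 487) ^ 81 ≠ 1 ∧ (-(9 : ZMod 487) ^ 2 - 9) ^ 81 = 1 := by
  refine ⟨?_, ?_, ?_, ?_, ?_, ?_⟩ <;> decide +kernel

/-- Certificate at `p = 499`: `k = 34`, `e = (p−1)/6 = 83`. [cite: FiteShparlinski2016, Lemma 6] -/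
private theorem cert_499 : (34 : ZMod 499) ≠ 0 ∧ (1 : ZMod 499) + 34 ≠ 0 ∧ (34 : ZMod 499) ^ 3 ≠ 1 ∧
    (34 : ZMod 499) ^ (3 * 83) = 1 ∧ (34 : ZMod 499) ^ 83 ≠ 1 ∧ (-(34 : ZMod 499) ^ 2 - 34) ^ 83 = 1 := by
  refine ⟨?_, ?_, ?_, ?_, ?_, ?_⟩ <;> decide +kernel

/-- Certificate at `p = 523`: `k = 4`, `e = (p−1)/6 = 87`. [cite: FiteShparlinski2016, Lemma 6] -/
private theorem cert_523 : (4 : ZMod 523) ≠ 0 ∧ (1 : ZMod 523) + 4 ≠ 0 ∧ (4 : ZMod 523) ^ 3 ≠ 1 ∧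
    (4 : ZMod 523) ^ (3 * 87) = 1 ∧ (4 : ZMod 523) ^ 87 ≠ 1 ∧ (-(4 : ZMod 523) ^ 2 - 4) ^ 87 = 1 := by
  refine ⟨?_, ?_, ?_, ?_, ?_, ?_⟩ <;> decide +kernel

/-- Certificate at `p = 547`: `k = 11`, `e = (p−1)/6 = 91`. [cite: FiteShparlinski2016, Lemma 6] -/
private theorem cert_547 : (11 : ZMod 547) ≠ 0 ∧ (1 : ZMod 547) + 11 ≠ 0 ∧ (11 : ZMod 547) ^ 3 ≠ 1 ∧
    (11 : ZMod 547) ^ (3 * 91) = 1 ∧ (11 : ZMod 547) ^ 91 ≠ 1 ∧ (-(11 : ZMod 547) ^ 2 - 11) ^ 91 = 1 := by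
  refine ⟨?_, ?_, ?_, ?_, ?_, ?_⟩ <;> decide +kernel

/-- Certificate at `p = 571`: `k = 9`, `e = (p−1)/6 = 95`. [cite: FiteShparlinski2016, Lemma 6] -/
private theorem cert_571 : (9 : ZMod 571) ≠ 0 ∧ (1 : ZMod 571) + 9 ≠ 0 ∧ (9 : ZMod 571) ^ 3 ≠ 1 ∧
    (9 : ZMod 571) ^ (3 * 95) = 1 ∧ (9 : ZMod 571) ^ 95 ≠ 1 ∧ (-(9 : ZMod 571) ^ 2 - 9) ^ 95 = 1 := by
  refine ⟨?_, ?_, ?_, ?_, ?_, ?_⟩ <;> decide +kernel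

/-- Certificate at `p = 607`: `k = 2`, `e = (p−1)/6 = 101`. [cite: FiteShparlinski2016, Lemma 6] -/
private theorem cert_607 : (2 : ZMod 607) ≠ 0 ∧ (1 : ZMod 607) + 2 ≠ 0 ∧ (2 : ZMod 607) ^ 3 ≠ 1 ∧
    (2 : ZMod 607) ^ (3 * 101) = 1 ∧ (2 : ZMod 607) ^ 101 ≠ 1 ∧ (-(2 : ZMod 607) ^ 2 - 2) ^ 101 = 1 := by
  refine ⟨?_, ?_, ?_, ?_, ?_, ?_⟩ <;> decide +kernel

/-- Certificate at `p = 619`: `k = 45`, `e = (p−1)/6 = 103`. [cite: FiteShparlinski2016, Lemma 6] -/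
private theorem cert_619 : (45 : ZMod 619) ≠ 0 ∧ (1 : ZMod 619) + 45 ≠ 0 ∧ (45 : ZMod 619) ^ 3 ≠ 1 ∧
    (45 : ZMod 619) ^ (3 * 103) = 1 ∧ (45 : ZMod 619) ^ 103 ≠ 1 ∧ (-(45 : ZMod 619) ^ 2 - 45) ^ 103 = 1 := by
  refine ⟨?_, ?_, ?_, ?_, ?_, ?_⟩ <;> decide +kernel

/-- Certificate at `p = 631`: `k = 2`, `e = (p−1)/6 = 105`. [cite: FiteShparlinski2016, Lemma 6] -/
private theorem cert_631 : (2 : ZMod 631) ≠ 0 ∧ (1 : ZMod 631) + 2 ≠ 0 ∧ (2 : ZMod 631) ^ 3 ≠ 1 ∧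
    (2 : ZMod 631) ^ (3 * 105) = 1 ∧ (2 : ZMod 631) ^ 105 ≠ 1 ∧ (-(2 : ZMod 631) ^ 2 - 2) ^ 105 = 1 := by
  refine ⟨?_, ?_, ?_, ?_, ?_, ?_⟩ <;> decide +kernel

/-- Certificate at `p = 643`: `k = 34`, `e = (p−1)/6 = 107`. [cite: FiteShparlinski2016, Lemma 6] -/
private theorem cert_643 : (34 : ZMod 643) ≠ 0 ∧ (1 : ZMod 643) + 34 ≠ 0 ∧ (34 : ZMod 643) ^ 3 ≠ 1 ∧
    (34 : ZMod 643) ^ (3 * 107) = 1 ∧ (34 : ZMod 643) ^ 107 ≠ 1 ∧ (-(34 : ZMod 643) ^ 2 - 34) ^ 107 = 1 := by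
  refine ⟨?_, ?_, ?_, ?_, ?_, ?_⟩ <;> decide +kernel

/-- Certificate at `p = 691`: `k = 43`, `e = (p−1)/6 = 115`. [cite: FiteShparlinski2016, Lemma 6] -/
private theorem cert_691 : (43 : ZMod 691) ≠ 0 ∧ (1 : ZMod 691) + 43 ≠ 0 ∧ (43 : ZMod 691) ^ 3 ≠ 1 ∧
    (43 : ZMod 691) ^ (3 * 115) = 1 ∧ (43 : ZMod 691) ^ 115 ≠ 1 ∧ (-(43 : ZMod 691) ^ 2 - 43) ^ 115 = 1 := by
  refine ⟨?_, ?_, ?_, ?_, ?_, ?_⟩ <;> decide +kernel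

/-- Certificate at `p = 727`: `k = 34`, `e = (p−1)/6 = 121`. [cite: FiteShparlinski2016, Lemma 6] -/
private theorem cert_727 : (34 : ZMod 727) ≠ 0 ∧ (1 : ZMod 727) + 34 ≠ 0 ∧ (34 : ZMod 727) ^ 3 ≠ 1 ∧
    (34 : ZMod 727) ^ (3 * 121) = 1 ∧ (34 : ZMod 727) ^ 121 ≠ 1 ∧ (-(34 : ZMod 727) ^ 2 - 34) ^ 121 = 1 := by
  refine ⟨?_, ?_, ?_, ?_, ?_, ?_⟩ <;> decide +kernel

/-- Certificate at `p = 739`: `k = 17`, `e = (p−1)/6 = 123`. [cite: FiteShparlinski2016, Lemma 6] -/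
private theorem cert_739 : (17 : ZMod 739) ≠ 0 ∧ (1 : ZMod 739) + 17 ≠ 0 ∧ (17 : ZMod 739) ^ 3 ≠ 1 ∧
    (17 : ZMod 739) ^ (3 * 123) = 1 ∧ (17 : ZMod 739) ^ 123 ≠ 1 ∧ (-(17 : ZMod 739) ^ 2 - 17) ^ 123 = 1 := by
  refine ⟨?_, ?_, ?_, ?_, ?_, ?_⟩ <;> decide +kernel

/-- Certificate at `p = 751`: `k = 2`, `e = (p−1)/6 = 125`. [cite: FiteShparlinski2016, Lemma 6] -/
private theorem cert_751 : (2 : ZMod 751) ≠ 0 ∧ (1 : ZMod 751) + 2 ≠ 0 ∧ (2 : ZMod 751) ^ 3 ≠ 1 ∧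
    (2 : ZMod 751) ^ (3 * 125) = 1 ∧ (2 : ZMod 751) ^ 125 ≠ 1 ∧ (-(2 : ZMod 751) ^ 2 - 2) ^ 125 = 1 := by
  refine ⟨?_, ?_, ?_, ?_, ?_, ?_⟩ <;> decide +kernel

/-- Certificate at `p = 787`: `k = 4`, `e = (p−1)/6 = 131`. [cite: FiteShparlinski2016, Lemma 6] -/
private theorem cert_787 : (4 : ZMod 787) ≠ 0 ∧ (1 : ZMod 787) + 4 ≠ 0 ∧ (4 : ZMod 787) ^ 3 ≠ 1 ∧
    (4 : ZMod 787) ^ (3 * 131) = 1 ∧ (4 : ZMod 787) ^ 131 ≠ 1 ∧ (-(4 : ZMod 787) ^ 2 - 4) ^ 131 = 1 := by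
  refine ⟨?_, ?_, ?_, ?_, ?_, ?_⟩ <;> decide +kernel

/-- Certificate at `p = 811`: `k = 20`, `e = (p−1)/6 = 135`. [cite: FiteShparlinski2016, Lemma 6] -/
private theorem cert_811 : (20 : ZMod 811) ≠ 0 ∧ (1 : ZMod 811) + 20 ≠ 0 ∧ (20 : ZMod 811) ^ 3 ≠ 1 ∧
    (20 : ZMod 811) ^ (3 * 135) = 1 ∧ (20 : ZMod 811) ^ 135 ≠ 1 ∧ (-(20 : ZMod 811) ^ 2 - 20) ^ 135 = 1 := by
  refine ⟨?_, ?_, ?_, ?_, ?_, ?_⟩ <;> decide +kernel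

/-- Certificate at `p = 823`: `k = 9`, `e = (p−1)/6 = 137`. [cite: FiteShparlinski2016, Lemma 6] -/
private theorem cert_823 : (9 : ZMod 823) ≠ 0 ∧ (1 : ZMod 823) + 9 ≠ 0 ∧ (9 : ZMod 823) ^ 3 ≠ 1 ∧
    (9 : ZMod 823) ^ (3 * 137) = 1 ∧ (9 : ZMod 823) ^ 137 ≠ 1 ∧ (-(9 : ZMod 823) ^ 2 - 9) ^ 137 = 1 := by
  refine ⟨?_, ?_, ?_, ?_, ?_, ?_⟩ <;> decide +kernel

/-- Certificate at `p = 859`: `k = 31`, `e = (p−1)/6 = 143`. [cite: FiteShparlinski2016, Lemma 6] -/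
private theorem cert_859 : (31 : ZMod 859) ≠ 0 ∧ (1 : ZMod 859) + 31 ≠ 0 ∧ (31 : ZMod 859) ^ 3 ≠ 1 ∧
    (31 : ZMod 859) ^ (3 * 143) = 1 ∧ (31 : ZMod 859) ^ 143 ≠ 1 ∧ (-(31 : ZMod 859) ^ 2 - 31) ^ 143 = 1 := by
  refine ⟨?_, ?_, ?_, ?_, ?_, ?_⟩ <;> decide +kernel

/-- Certificate at `p = 883`: `k = 4`, `e = (p−1)/6 = 147`. [cite: FiteShparlinski2016, Lemma 6] -/
private theorem cert_883 : (4 : ZMod 883) ≠ 0 ∧ (1 : ZMod 883) + 4 ≠ 0 ∧ (4 : ZMod 883) ^ 3 ≠ 1 ∧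
    (4 : ZMod 883) ^ (3 * 147) = 1 ∧ (4 : ZMod 883) ^ 147 ≠ 1 ∧ (-(4 : ZMod 883) ^ 2 - 4) ^ 147 = 1 := by
  refine ⟨?_, ?_, ?_, ?_, ?_, ?_⟩ <;> decide +kernel

/-- Certificate at `p = 907`: `k = 16`, `e = (p−1)/6 = 151`. [cite: FiteShparlinski2016, Lemma 6] -/
private theorem cert_907 : (16 : ZMod 907) ≠ 0 ∧ (1 : ZMod 907) + 16 ≠ 0 ∧ (16 : ZMod 907) ^ 3 ≠ 1 ∧
    (16 : ZMod 907) ^ (3 * 151) = 1 ∧ (16 : ZMod 907) ^ 151 ≠ 1 ∧ (-(16 : ZMod 907) ^ 2 - 16) ^ 151 = 1 := by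
  refine ⟨?_, ?_, ?_, ?_, ?_, ?_⟩ <;> decide +kernel

/-- Certificate at `p = 919`: `k = 42`, `e = (p−1)/6 = 153`. [cite: FiteShparlinski2016, Lemma 6] -/
private theorem cert_919 : (42 : ZMod 919) ≠ 0 ∧ (1 : ZMod 919) + 42 ≠ 0 ∧ (42 : ZMod 919) ^ 3 ≠ 1 ∧
    (42 : ZMod 919) ^ (3 * 153) = 1 ∧ (42 : ZMod 919) ^ 153 ≠ 1 ∧ (-(42 : ZMod 919) ^ 2 - 42) ^ 153 = 1 := by
  refine ⟨?_, ?_, ?_, ?_, ?_, ?_⟩ <;> decide +kernel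

/-- Certificate at `p = 967`: `k = 84`, `e = (p−1)/6 = 161`. [cite: FiteShparlinski2016, Lemma 6] -/
private theorem cert_967 : (84 : ZMod 967) ≠ 0 ∧ (1 : ZMod 967) + 84 ≠ 0 ∧ (84 : ZMod 967) ^ 3 ≠ 1 ∧
    (84 : ZMod 967) ^ (3 * 161) = 1 ∧ (84 : ZMod 967) ^ 161 ≠ 1 ∧ (-(84 : ZMod 967) ^ 2 - 84) ^ 161 = 1 := by
  refine ⟨?_, ?_, ?_, ?_, ?_, ?_⟩ <;> decide +kernel

/-- Certificate at `p = 991`: `k = 10`, `e = (p−1)/6 = 165`. [cite: FiteShparlinski2016, Lemma 6] -/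
private theorem cert_991 : (10 : ZMod 991) ≠ 0 ∧ (1 : ZMod 991) + 10 ≠ 0 ∧ (10 : ZMod 991) ^ 3 ≠ 1 ∧
    (10 : ZMod 991) ^ (3 * 165) = 1 ∧ (10 : ZMod 991) ^ 165 ≠ 1 ∧ (-(10 : ZMod 991) ^ 2 - 10) ^ 165 = 1 := by
  refine ⟨?_, ?_, ?_, ?_, ?_, ?_⟩ <;> decide +kernel

/-- Certificate at `p = 1039`: `k = 45`, `e = (p−1)/6 = 173`. [cite: FiteShparlinski2016, Lemma 6] -/
private theorem cert_1039 : (45 : ZMod 1039) ≠ 0 ∧ (1 : ZMod 1039) + 45 ≠ 0 ∧ (45 : ZMod 1039) ^ 3 ≠ 1 ∧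
    (45 : ZMod 1039) ^ (3 * 173) = 1 ∧ (45 : ZMod 1039) ^ 173 ≠ 1 ∧ (-(45 : ZMod 1039) ^ 2 - 45) ^ 173 = 1 := by
  refine ⟨?_, ?_, ?_, ?_, ?_, ?_⟩ <;> decide +kernel

/-- Certificate at `p = 1051`: `k = 21`, `e = (p−1)/6 = 175`. [cite: FiteShparlinski2016, Lemma 6] -/
private theorem cert_1051 : (21 : ZMod 1051) ≠ 0 ∧ (1 : ZMod 1051) + 21 ≠ 0 ∧ (21 : ZMod 1051) ^ 3 ≠ 1 ∧
    (21 : ZMod 1051) ^ (3 * 175) = 1 ∧ (21 : ZMod 1051) ^ 175 ≠ 1 ∧ (-(21 : ZMod 1051) ^ 2 - 21) ^ 175 = 1 := by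
  refine ⟨?_, ?_, ?_, ?_, ?_, ?_⟩ <;> decide +kernel

/-- Certificate at `p = 1063`: `k = 9`, `e = (p−1)/6 = 177`. [cite: FiteShparlinski2016, Lemma 6] -/
private theorem cert_1063 : (9 : ZMod 1063) ≠ 0 ∧ (1 : ZMod 1063) + 9 ≠ 0 ∧ (9 : ZMod 1063) ^ 3 ≠ 1 ∧
    (9 : ZMod 1063) ^ (3 * 177) = 1 ∧ (9 : ZMod 1063) ^ 177 ≠ 1 ∧ (-(9 : ZMod 1063) ^ 2 - 9) ^ 177 = 1 := by
  refine ⟨?_, ?_, ?_, ?_, ?_, ?_⟩ <;> decide +kernel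

/-- Certificate at `p = 1087`: `k = 2`, `e = (p−1)/6 = 181`. [cite: FiteShparlinski2016, Lemma 6] -/
private theorem cert_1087 : (2 : ZMod 1087) ≠ 0 ∧ (1 : ZMod 1087) + 2 ≠ 0 ∧ (2 : ZMod 1087) ^ 3 ≠ 1 ∧
    (2 : ZMod 1087) ^ (3 * 181) = 1 ∧ (2 : ZMod 1087) ^ 181 ≠ 1 ∧ (-(2 : ZMod 1087) ^ 2 - 2) ^ 181 = 1 := by
  refine ⟨?_, ?_, ?_, ?_, ?_, ?_⟩ <;> decide +kernel

/-- Certificate at `p = 1123`: `k = 68`, `e = (p−1)/6 = 187`. [cite: FiteShparlinski2016, Lemma 6] -/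
private theorem cert_1123 : (68 : ZMod 1123) ≠ 0 ∧ (1 : ZMod 1123) + 68 ≠ 0 ∧ (68 : ZMod 1123) ^ 3 ≠ 1 ∧
    (68 : ZMod 1123) ^ (3 * 187) = 1 ∧ (68 : ZMod 1123) ^ 187 ≠ 1 ∧ (-(68 : ZMod 1123) ^ 2 - 68) ^ 187 = 1 := by
  refine ⟨?_, ?_, ?_, ?_, ?_, ?_⟩ <;> decide +kernel

/-- Certificate at `p = 1171`: `k = 9`, `e = (p−1)/6 = 195`. [cite: FiteShparlinski2016, Lemma 6] -/
private theorem cert_1171 : (9 : ZMod 1171) ≠ 0 ∧ (1 : ZMod 1171) + 9 ≠ 0 ∧ (9 : ZMod 1171) ^ 3 ≠ 1 ∧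
    (9 : ZMod 1171) ^ (3 * 195) = 1 ∧ (9 : ZMod 1171) ^ 195 ≠ 1 ∧ (-(9 : ZMod 1171) ^ 2 - 9) ^ 195 = 1 := by
  refine ⟨?_, ?_, ?_, ?_, ?_, ?_⟩ <;> decide +kernel

/-- Certificate at `p = 1231`: `k = 22`, `e = (p−1)/6 = 205`. [cite: FiteShparlinski2016, Lemma 6] -/
private theorem cert_1231 : (22 : ZMod 1231) ≠ 0 ∧ (1 : ZMod 1231) + 22 ≠ 0 ∧ (22 : ZMod 1231) ^ 3 ≠ 1 ∧
    (22 : ZMod 1231) ^ (3 * 205) = 1 ∧ (22 : ZMod 1231) ^ 205 ≠ 1 ∧ (-(22 : ZMod 1231) ^ 2 - 22) ^ 205 = 1 := by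
  refine ⟨?_, ?_, ?_, ?_, ?_, ?_⟩ <;> decide +kernel

/-- Certificate at `p = 1279`: `k = 5`, `e = (p−1)/6 = 213`. [cite: FiteShparlinski2016, Lemma 6] -/
private theorem cert_1279 : (5 : ZMod 1279) ≠ 0 ∧ (1 : ZMod 1279) + 5 ≠ 0 ∧ (5 : ZMod 1279) ^ 3 ≠ 1 ∧
    (5 : ZMod 1279) ^ (3 * 213) = 1 ∧ (5 : ZMod 1279) ^ 213 ≠ 1 ∧ (-(5 : ZMod 1279) ^ 2 - 5) ^ 213 = 1 := by
  refine ⟨?_, ?_, ?_, ?_, ?_, ?_⟩ <;> decide +kernel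

/-- Certificate at `p = 1291`: `k = 49`, `e = (p−1)/6 = 215`. [cite: FiteShparlinski2016, Lemma 6] -/
private theorem cert_1291 : (49 : ZMod 1291) ≠ 0 ∧ (1 : ZMod 1291) + 49 ≠ 0 ∧ (49 : ZMod 1291) ^ 3 ≠ 1 ∧
    (49 : ZMod 1291) ^ (3 * 215) = 1 ∧ (49 : ZMod 1291) ^ 215 ≠ 1 ∧ (-(49 : ZMod 1291) ^ 2 - 49) ^ 215 = 1 := by
  refine ⟨?_, ?_, ?_, ?_, ?_, ?_⟩ <;> decide +kernel

/-- **`K_p ≠ ∅` for the thirty-three primes `p ≡ 7 (mod 12)` with `400 ≤ p ≤ 1296`**, by the certificates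
`(k, e = (p−1)/6)` above (`k^{3e} = 1 ≠ k^e`, `(−k²−k)^e = 1`, `k³ ≠ 1`). [cite: FiteShparlinski2016, Lemma 6] -/
theorem exists_not_isNondegenerate_fermat_of_mem_certified
    (hmem : p ∈ ({439, 463, 487, 499, 523, 547, 571, 607, 619, 631, 643, 691, 727, 739, 751, 787, 811,
        823, 859, 883, 907, 919, 967, 991, 1039, 1051, 1063, 1087, 1123, 1171, 1231, 1279, 1291} : Finset ℕ)) :
    ∃ a : ZMod p, ∃ (ha : a ≠ 0) (ha1 : 1 + a ≠ 0), orderOf a ≠ 3 ∧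
      ¬ IsNondegenerate (cmTypeOfResidues (L := L) (fermatCMType p 1 a (-1 - a)) (fermatCMType_one_cm ha ha1)) := by
  simp only [Finset.mem_insert, Finset.mem_singleton] at hmem
  rcases hmem with rfl | rfl | rfl | rfl | rfl | rfl | rfl | rfl | rfl | rfl | rfl | rfl | rfl | rfl | rfl | rfl | rfl |
    rfl | rfl | rfl | rfl | rfl | rfl | rfl | rfl | rfl | rfl | rfl | rfl | rfl | rfl | rfl | rfl
  · obtain ⟨h0, h1, h3, hM, hne, hh⟩ := cert_439
    exact ⟨29, h0, h1, not_isNondegenerate_fermat_of_certificate L h0 h1 (by decide) h3 hM hne hh⟩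
  · obtain ⟨h0, h1, h3, hM, hne, hh⟩ := cert_463
    exact ⟨25, h0, h1, not_isNondegenerate_fermat_of_certificate L h0 h1 (by decide) h3 hM hne hh⟩
  · obtain ⟨h0, h1, h3, hM, hne, hh⟩ := cert_487
    exact ⟨9, h0, h1, not_isNondegenerate_fermat_of_certificate L h0 h1 (by decide) h3 hM hne hh⟩
  · obtain ⟨h0, h1, h3, hM, hne, hh⟩ := cert_499
    exact ⟨34, h0, h1, not_isNondegenerate_fermat_of_certificate L h0 h1 (by decide) h3 hM hne hh⟩
  · obtain ⟨h0, h1, h3, hM, hne, hh⟩ := cert_523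
    exact ⟨4, h0, h1, not_isNondegenerate_fermat_of_certificate L h0 h1 (by decide) h3 hM hne hh⟩
  · obtain ⟨h0, h1, h3, hM, hne, hh⟩ := cert_547
    exact ⟨11, h0, h1, not_isNondegenerate_fermat_of_certificate L h0 h1 (by decide) h3 hM hne hh⟩
  · obtain ⟨h0, h1, h3, hM, hne, hh⟩ := cert_571
    exact ⟨9, h0, h1, not_isNondegenerate_fermat_of_certificate L h0 h1 (by decide) h3 hM hne hh⟩
  · obtain ⟨h0, h1, h3, hM, hne, hh⟩ := cert_607
    exact ⟨2, h0, h1, not_isNondegenerate_fermat_of_certificate L h0 h1 (by decide) h3 hM hne hh⟩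
  · obtain ⟨h0, h1, h3, hM, hne, hh⟩ := cert_619
    exact ⟨45, h0, h1, not_isNondegenerate_fermat_of_certificate L h0 h1 (by decide) h3 hM hne hh⟩
  · obtain ⟨h0, h1, h3, hM, hne, hh⟩ := cert_631
    exact ⟨2, h0, h1, not_isNondegenerate_fermat_of_certificate L h0 h1 (by decide) h3 hM hne hh⟩
  · obtain ⟨h0, h1, h3, hM, hne, hh⟩ := cert_643
    exact ⟨34, h0, h1, not_isNondegenerate_fermat_of_certificate L h0 h1 (by decide) h3 hM hne hh⟩
  · obtain ⟨h0, h1, h3, hM, hne, hh⟩ := cert_691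
    exact ⟨43, h0, h1, not_isNondegenerate_fermat_of_certificate L h0 h1 (by decide) h3 hM hne hh⟩
  · obtain ⟨h0, h1, h3, hM, hne, hh⟩ := cert_727
    exact ⟨34, h0, h1, not_isNondegenerate_fermat_of_certificate L h0 h1 (by decide) h3 hM hne hh⟩
  · obtain ⟨h0, h1, h3, hM, hne, hh⟩ := cert_739
    exact ⟨17, h0, h1, not_isNondegenerate_fermat_of_certificate L h0 h1 (by decide) h3 hM hne hh⟩
  · obtain ⟨h0, h1, h3, hM, hne, hh⟩ := cert_751
    exact ⟨2, h0, h1, not_isNondegenerate_fermat_of_certificate L h0 h1 (by decide) h3 hM hne hh⟩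
  · obtain ⟨h0, h1, h3, hM, hne, hh⟩ := cert_787
    exact ⟨4, h0, h1, not_isNondegenerate_fermat_of_certificate L h0 h1 (by decide) h3 hM hne hh⟩
  · obtain ⟨h0, h1, h3, hM, hne, hh⟩ := cert_811
    exact ⟨20, h0, h1, not_isNondegenerate_fermat_of_certificate L h0 h1 (by decide) h3 hM hne hh⟩
  · obtain ⟨h0, h1, h3, hM, hne, hh⟩ := cert_823
    exact ⟨9, h0, h1, not_isNondegenerate_fermat_of_certificate L h0 h1 (by decide) h3 hM hne hh⟩
  · obtain ⟨h0, h1, h3, hM, hne, hh⟩ := cert_859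
    exact ⟨31, h0, h1, not_isNondegenerate_fermat_of_certificate L h0 h1 (by decide) h3 hM hne hh⟩
  · obtain ⟨h0, h1, h3, hM, hne, hh⟩ := cert_883
    exact ⟨4, h0, h1, not_isNondegenerate_fermat_of_certificate L h0 h1 (by decide) h3 hM hne hh⟩
  · obtain ⟨h0, h1, h3, hM, hne, hh⟩ := cert_907
    exact ⟨16, h0, h1, not_isNondegenerate_fermat_of_certificate L h0 h1 (by decide) h3 hM hne hh⟩
  · obtain ⟨h0, h1, h3, hM, hne, hh⟩ := cert_919
    exact ⟨42, h0, h1, not_isNondegenerate_fermat_of_certificate L h0 h1 (by decide) h3 hM hne hh⟩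
  · obtain ⟨h0, h1, h3, hM, hne, hh⟩ := cert_967
    exact ⟨84, h0, h1, not_isNondegenerate_fermat_of_certificate L h0 h1 (by decide) h3 hM hne hh⟩
  · obtain ⟨h0, h1, h3, hM, hne, hh⟩ := cert_991
    exact ⟨10, h0, h1, not_isNondegenerate_fermat_of_certificate L h0 h1 (by decide) h3 hM hne hh⟩
  · obtain ⟨h0, h1, h3, hM, hne, hh⟩ := cert_1039
    exact ⟨45, h0, h1, not_isNondegenerate_fermat_of_certificate L h0 h1 (by decide) h3 hM hne hh⟩
  · obtain ⟨h0, h1, h3, hM, hne, hh⟩ := cert_1051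
    exact ⟨21, h0, h1, not_isNondegenerate_fermat_of_certificate L h0 h1 (by decide) h3 hM hne hh⟩
  · obtain ⟨h0, h1, h3, hM, hne, hh⟩ := cert_1063
    exact ⟨9, h0, h1, not_isNondegenerate_fermat_of_certificate L h0 h1 (by decide) h3 hM hne hh⟩
  · obtain ⟨h0, h1, h3, hM, hne, hh⟩ := cert_1087
    exact ⟨2, h0, h1, not_isNondegenerate_fermat_of_certificate L h0 h1 (by decide) h3 hM hne hh⟩
  · obtain ⟨h0, h1, h3, hM, hne, hh⟩ := cert_1123
    exact ⟨68, h0, h1, not_isNondegenerate_fermat_of_certificate L h0 h1 (by decide) h3 hM hne hh⟩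
  · obtain ⟨h0, h1, h3, hM, hne, hh⟩ := cert_1171
    exact ⟨9, h0, h1, not_isNondegenerate_fermat_of_certificate L h0 h1 (by decide) h3 hM hne hh⟩
  · obtain ⟨h0, h1, h3, hM, hne, hh⟩ := cert_1231
    exact ⟨22, h0, h1, not_isNondegenerate_fermat_of_certificate L h0 h1 (by decide) h3 hM hne hh⟩
  · obtain ⟨h0, h1, h3, hM, hne, hh⟩ := cert_1279
    exact ⟨5, h0, h1, not_isNondegenerate_fermat_of_certificate L h0 h1 (by decide) h3 hM hne hh⟩
  · obtain ⟨h0, h1, h3, hM, hne, hh⟩ := cert_1291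
    exact ⟨49, h0, h1, not_isNondegenerate_fermat_of_certificate L h0 h1 (by decide) h3 hM hne hh⟩

omit hp in
/-- The primes `p ≡ 7 (mod 12)` in `[400, 1296]` are the thirty-three certified ones. [folklore] -/
private theorem mem_certified_of_le [hp : Fact p.Prime] (h12 : p % 12 = 7) (h400 : 400 ≤ p) (h1296 : p ≤ 1296) :
    p ∈ ({439, 463, 487, 499, 523, 547, 571, 607, 619, 631, 643, 691, 727, 739, 751, 787, 811,
        823, 859, 883, 907, 919, 967, 991, 1039, 1051, 1063, 1087, 1123, 1171, 1231, 1279, 1291} : Finset ℕ) := by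
  have hprime := hp.out
  obtain ⟨q, rfl⟩ : ∃ q, p = 12 * q + 7 := ⟨p / 12, by omega⟩
  have hq1 : 33 ≤ q := by omega
  have hq2 : q ≤ 107 := by omega
  interval_cases q <;> first | decide | exact absurd hprime (by norm_num)

omit hp in
/-- The primes `p ≡ 7 (mod 12)` below `400` outside `{7, 19, 31, 43, 79, 103}` are `67` and those `≥ 127`.
[folklore] -/
private theorem eq_or_le_of_lt_four_hundred [hp : Fact p.Prime] (h12 : p % 12 = 7) (h400 : p < 400)
    (hnot : p ∉ ({7, 19, 31, 43, 79, 103} : Finset ℕ)) : p = 67 ∨ 127 ≤ p := by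
  have hprime := hp.out
  obtain ⟨q, rfl⟩ : ∃ q, p = 12 * q + 7 := ⟨p / 12, by omega⟩
  have hq2 : q ≤ 32 := by omega
  interval_cases q <;>
    first | (right; omega) | (left; omega) | exact absurd (by decide) hnot | exact absurd hprime (by norm_num)

end Certificates

/-! ## §8 Corollary 3, corrected: for primes `ℓ ≡ 7 (mod 12)`, `K_ℓ = ∅` iff `ℓ ∈ {7, 19, 31, 43, 79, 103}` -/

section Corrected

variable {p : ℕ} [hp : Fact p.Prime] (L : Type) [Field L] [NumberField L] [IsCyclotomicExtension {p} ℚ L]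

/-- **Fité–Shparlinski Corollary 3, CORRECTED («For every prime `ℓ ≡ 7 (mod 12)` distinct from `7` and `19` we
have `#K_ℓ > 0`» is false for `31, 43, 79, 103`): for every prime `p ≡ 7 (mod 12)`, `K_p ≠ ∅` — some Fermat CM
type `Φ_{S_k}` of the `p`-th cyclotomic field with `k ≠ 0, −1`, `ord k ≠ 3` is DEGENERATE — if and only if
`p ∉ {7, 19, 31, 43, 79, 103}`.**  Below `400` this is [FGL] Remark 3.4 (tree); on `[400, 1296]` the thirty-three
certificates of §7; above `1296` Lenstra's character-sum mechanism (§6).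
[cite: FiteShparlinski2016, Cor. 3] [cite: FiteGonzalezLario2016, Remark 3.4]
[cite: Greenberg1980, (Lenstra–Stark remark)] -/
theorem exists_not_isNondegenerate_fermat_iff_not_mem (h12 : p % 12 = 7) :
    (∃ a : ZMod p, ∃ (ha : a ≠ 0) (ha1 : 1 + a ≠ 0), orderOf a ≠ 3 ∧
        ¬ IsNondegenerate (cmTypeOfResidues (L := L) (fermatCMType p 1 a (-1 - a)) (fermatCMType_one_cm ha ha1))) ↔
      p ∉ ({7, 19, 31, 43, 79, 103} : Finset ℕ) := by
  constructor
  · rintro hex hmem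
    have hp400 : p < 400 := by
      simp only [Finset.mem_insert, Finset.mem_singleton] at hmem
      omega
    have h := (exists_not_isNondegenerate_fermat_iff_of_mod_twelve L hp400 h12).1 hex
    simp only [Finset.mem_insert, Finset.mem_singleton] at hmem
    omega
  · intro hnot
    by_cases h400 : p < 400
    · exact (exists_not_isNondegenerate_fermat_iff_of_mod_twelve L h400 h12).2
        (eq_or_le_of_lt_four_hundred h12 h400 hnot)
    · by_cases h1296 : p ≤ 1296
      · exact exists_not_isNondegenerate_fermat_of_mem_certified L (mem_certified_of_le h12 (by omega) h1296)
      · exact exists_not_isNondegenerate_fermat_of_gt L h12 (by omega)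

/-- **The six exceptional primes**: for `p ∈ {7, 19, 31, 43, 79, 103}` every `Φ_{S_k}` (`k ≠ 0, −1`, `ord k ≠ 3`) of
the `p`-th cyclotomic field is nondegenerate (`K_p = ∅`; hence the Hodge conjecture for all powers of the
abelian varieties of these types, tree `IsNondegenerate.hodgeConjectureFor_pow`).
[cite: FiteGonzalezLario2016, Remark 3.4] [cite: FiteShparlinski2016, Cor. 3] -/
theorem isNondegenerate_fermat_of_mem_exceptions (hmem : p ∈ ({7, 19, 31, 43, 79, 103} : Finset ℕ))
    {a : ZMod p} (ha : a ≠ 0) (ha1 : 1 + a ≠ 0) (h3 : orderOf a ≠ 3)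
    {hS : ∀ c : ZMod p, c.val.Coprime p → (c ∈ fermatCMType p 1 a (-1 - a) ↔ -c ∉ fermatCMType p 1 a (-1 - a))} :
    IsNondegenerate (cmTypeOfResidues (L := L) (fermatCMType p 1 a (-1 - a)) hS) := by
  simp only [Finset.mem_insert, Finset.mem_singleton] at hmem
  refine isNondegenerate_fermat_of_not_mem L (by omega) ?_ ha ha1 h3
  simp only [Finset.mem_insert, Finset.mem_singleton]
  omega

/-- **Lenstra's observation as printed** («`K_ℓ` is non-empty for every sufficiently large `ℓ ≡ 7 (mod 12)`»),
with the sharp threshold: every prime `p ≡ 7 (mod 12)` with `p > 103` has `K_p ≠ ∅`.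
[cite: FiteShparlinski2016, §1 (Lenstra's observation)] [cite: Greenberg1980, (Lenstra–Stark remark)] -/
theorem exists_not_isNondegenerate_fermat_of_gt_103 (h12 : p % 12 = 7) (h103 : 103 < p) :
    ∃ a : ZMod p, ∃ (ha : a ≠ 0) (ha1 : 1 + a ≠ 0), orderOf a ≠ 3 ∧
      ¬ IsNondegenerate (cmTypeOfResidues (L := L) (fermatCMType p 1 a (-1 - a)) (fermatCMType_one_cm ha ha1)) :=
  (exists_not_isNondegenerate_fermat_iff_not_mem L h12).2 (by
    simp only [Finset.mem_insert, Finset.mem_singleton]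
    omega)

end Corrected

/-! ## §9 On abelian varieties: degenerate simple CM factors of `J(F_p)` for every `p ≡ 7 (mod 12)`, `p > 103` -/

section Hodge

open NumberField CategoryTheory CategoryTheory.Limits
open Literature.AlgebraicGeometry.Motives (AbelianVariety)
open Literature.AlgebraicGeometry.HodgeTheory
open Literature.Barriers.HodgeConjecture (divisorClassesSpan)

variable {p : ℕ} [hp : Fact p.Prime] (L : Type) [Field L] [NumberField L] [IsCyclotomicExtension {p} ℚ L]

/-- `ℚ(ζ_p)` is a CM field for an odd prime `p` (Mathlib). [folklore] -/
private theorem isCMField_of_odd (hp2 : p ≠ 2) : IsCMField L :=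
  IsCyclotomicExtension.Rat.isCMField L (S := {p})
    ⟨p, rfl, lt_of_le_of_ne hp.out.two_le (Ne.symm hp2)⟩

/-- **Corollary 3 corrected, ON ABELIAN VARIETIES.** For every prime `p ≡ 7 (mod 12)` outside
`{7, 19, 31, 43, 79, 103}` there is a Fermat CM type `Φ_{S_k}` of the `p`-th cyclotomic field (`k ≠ 0, −1`,
`ord k ≠ 3`) and a SIMPLE abelian variety `B` of dimension `(p−1)/2` of that type (a realisation exists by Shimura
§6.2 Thm. 3 = tree `exists_isCMTypeRealisation`; e.g. the simple factor `Jac(C_{k,p})` of the Fermat Jacobian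
`J(F_p)`) some power of which carries a rational `(m,m)`-class outside `Dᵐ ⊗ ℂ` — an exceptional Hodge class
(degenerate type: [FGL] Thm. 4.10 / Lemma 3.3 `dim Hg(Jac(C_k)) < (p−1)/2`; tree
`isSimple_and_exists_exceptional_pow_of_orderOf`). [cite: FiteShparlinski2016, Cor. 3 and Lemma 6]
[cite: FiteGonzalezLario2016, Thm. 4.10 and Lemma 3.3] [cite: Shimura1998, §6.2 Thm. 3] -/
theorem exists_isSimple_exceptional_pow_of_mod_twelve (h12 : p % 12 = 7)
    (hnot : p ∉ ({7, 19, 31, 43, 79, 103} : Finset ℕ)) :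
    ∃ (a : ZMod p) (ha : a ≠ 0) (ha1 : 1 + a ≠ 0) (B : AbelianVariety ℂ) (ι' : 𝓞 L →+* End B)
      (θ' : L →+* Module.End ℂ (complexBetti B.X 1)),
      orderOf a ≠ 3 ∧
      IsCMTypeRealisation (cmTypeOfResidues (L := L) (fermatCMType p 1 a (-1 - a)) (fermatCMType_one_cm ha ha1))
          B ι' θ' ∧ B.IsSimple ∧ B.dim = (p - 1) / 2 ∧
        ∃ n m : ℕ, ∃ c : complexBetti (⨁ fun _ : Fin n => B).X (2 * m), IsRationalClass c ∧
          IsOfHodgeType (⨁ fun _ : Fin n => B).dim (⨁ fun _ : Fin n => B).X (2 * m) m m c ∧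
          c ∉ divisorClassesSpan (⨁ fun _ : Fin n => B).X (⨁ fun _ : Fin n => B).dim m := by
  haveI : NeZero p := ⟨hp.out.ne_zero⟩
  haveI := isCMField_of_odd L (by omega : p ≠ 2)
  obtain ⟨a, ha, ha1, h3, hdeg⟩ := (exists_not_isNondegenerate_fermat_iff_not_mem L h12).2 hnot
  rw [isNondegenerate_fermat_iff_orderOf L ha ha1, not_not] at hdeg
  obtain ⟨B, ι', θ', hB⟩ :=
    exists_isCMTypeRealisation (cmTypeOfResidues (L := L) (fermatCMType p 1 a (-1 - a)) (fermatCMType_one_cm ha ha1))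
  have hex := isSimple_and_exists_exceptional_pow_of_orderOf (L := L) ha ha1 h3 ⟨hdeg.1, hdeg.2.1⟩ hdeg.2.2 hB
  refine ⟨a, ha, ha1, B, ι', θ', h3, hB, hex.1, ?_, hex.2⟩
  have h := Motives.schemeDim_eq_holds hB.1
  rw [finrank_eq_totient p L, Nat.totient_prime hp.out] at h
  exact h

variable {L} in
/-- **The six exceptional primes, ON ABELIAN VARIETIES**: for `p ∈ {7, 19, 31, 43, 79, 103}` every abelian variety
of every Fermat type `Φ_{S_k}` of the `p`-th cyclotomic field (`k ≠ 0, −1`, `ord k ≠ 3`) satisfies, with all its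
powers, the Hodge conjecture — unconditionally (nondegenerate type, White–Hazama; tree
`hodgeConjectureFor_pow_fermat_of_not_degenerate`). [cite: FiteGonzalezLario2016, Remark 3.4 and Thm. 1.2]
[cite: Gordon1999HodgeAVSurvey, Thm. 6.4 and §9.3] -/
theorem hodgeConjectureFor_pow_fermat_of_mem_exceptions (hmem : p ∈ ({7, 19, 31, 43, 79, 103} : Finset ℕ))
    {a : ZMod p} (ha : a ≠ 0) (ha1 : 1 + a ≠ 0) (h3 : orderOf a ≠ 3)
    {hS : ∀ c : ZMod p, c.val.Coprime p → (c ∈ fermatCMType p 1 a (-1 - a) ↔ -c ∉ fermatCMType p 1 a (-1 - a))}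
    {A : AbelianVariety ℂ} {ι : 𝓞 L →+* End A} {θ : L →+* Module.End ℂ (complexBetti A.X 1)}
    (hA : IsCMTypeRealisation (cmTypeOfResidues (L := L) (fermatCMType p 1 a (-1 - a)) hS) A ι θ) (k : ℕ) :
    HodgeConjectureFor (⨁ fun _ : Fin k => A).dim (⨁ fun _ : Fin k => A).X :=
  hodgeConjectureFor_pow_fermat_of_not_degenerate ha ha1
    ((isNondegenerate_fermat_iff_orderOf L ha ha1 (hS := hS)).1
      (isNondegenerate_fermat_of_mem_exceptions L hmem ha ha1 h3)) hA k

end Hodge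

end CyclotomicFermatCMType

end Literature.AlgebraicGeometry.ComplexMultiplication
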